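import Literature.MathematicalPhysics.QuantumLattice.FermionOperatorsProofs
import Literature.MathematicalPhysics.QuantumLattice.HubbardWave0PosSemidefProofs
import Literature.MathematicalPhysics.QuantumLattice.HubbardLiebConfig
import Literature.MathematicalPhysics.QuantumLattice.LiebSpinReflection
import HarnessLib

/-!
# Proof of Lieb's Theorem 1 (attractive Hubbard model): discharge of `lieb_attractive`

Family `hubbard` (trunk T-QLATTICE), statement hubbard.S09. Sibling proof file of
`Literature/MathematicalPhysics/QuantumLattice/HubbardWave0.lean`: it proves the named fact
`Literature.MathematicalPhysics.QuantumLattice.lieb_attractive` (Lieb, PRL 62 (1989) 1201, Theorem 1(b)) for the concrete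
Jordan–Wigner model of that file, and on the way the named fact
`Literature.MathematicalPhysics.QuantumLattice.hamiltonian_isHermitian_and_commute` (hubbard.S05). No statement is introduced or
changed here; the vocabulary (`pairSet`, `pairSign`, sectors, `Config`, `liebK`, `liebL`, `liebW`,
hopping moves) is in `HubbardLiebConfig`, the CAR and the entries of the Jordan–Wigner matrices in
`FermionOperatorsProofs` / `HubbardWave0PosSemidefProofs` (reused; the few further matrix elements
of fermion bilinears needed here are proved in the first section), and the abstract matrix
argument (`IsLiebSystem`, spin-reflection positivity, uniqueness) in `LiebSpinReflection`.

All auxiliary results are in the sub-namespace `Literature.Hubbard.LiebThm1`; only the two discharges below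
are in `Literature.Hubbard`.

## Proved here

* `hamiltonian_isHermitian_and_commute_holds` — `H` is Hermitian and commutes with `N`, `S^z`.
* `lieb_attractive_holds : lieb_attractive G` — for `U < 0`, `t ≠ 0`, `G` connected, `N` even,
  `N ≤ 2|Λ|`: ground states in the `N`-particle sector are unique up to scalars and `S² ψ = 0`.

## Architecture of the proof (Lieb 1989, proof of Theorem 1, with the `SU(2)` step made explicit)

1. *Sectors.* `H` conserves `N↑`, `N↓` (`preservesSectors_hamiltonian`) and commutes with `S⁺`,
   `S⁻` (`hamiltonian_commute_spinPlus/Minus`, from the bilinear CAR commutators); `S^z` acts as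
   `(N↑ - N↓)/2`, `[S⁺, S⁻] = 2S^z`, so `‖S⁻v‖² - ‖S⁺v‖² = (a - b)‖v‖²` on the sector `(a, b)` and
   `S⁻` (`S⁺`) is injective when `a > b` (`a < b`).
2. *Transfer* (`S^z = 0` sector, `n = N/2`). `ψ ↦ W(ψ)`, `W_{αβ} = σ(α,β) ψ(α↑ ∪ β↓)`, is unitary
   from the `(n, n)` sector onto `m × m` matrices (`hsInner_liebW`) and intertwines `H` with
   `𝓗 W = KW + WK + U Σ_x L_x W L_x` (`liebW_hamiltonian_mulVec`; the Jordan–Wigner signs of the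
   site-major orbital order are absorbed by `σ`, see `liebW_hopping_up/down_mulVec`).
3. *Irreducibility* (`liebKL_irreducible`): `G` connected and `t ≠ 0` imply that no proper
   nonzero subspace is invariant under `K` and all `L_x` (hopping moves connect all `n`-subsets,
   `reflTransGen_isHop`; the `L_x` generate the projectors onto basis vectors).
4. *Matrix argument* (`LiebSpinReflection`): `IsLiebSystem.exists_eq_smul` and
   `IsLiebSystem.apply_self_ne_zero` give, in the `(n, n)` sector, uniqueness of the ground state
   and `ψ(α↑ ∪ α↓) ≠ 0` for all `α` (`lieb_core`).
5. *Assembly* (`lieb_attractive_holds`): an `(n, n)` ground state `ψ₀` has `S⁺ψ₀ = S⁻ψ₀ = 0`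
   (`S⁻S⁺ψ₀ = cψ₀` vanishes on paired configurations, where `ψ₀` does not); a ground-state
   component in a sector `(a, b)`, `a > b`, is mapped by `S⁻` step by step to the `(n, n)` sector,
   where `S⁺` kills it, so it vanishes by injectivity (symmetrically for `a < b`); hence all ground
   states lie in the `(n, n)` sector, are proportional, and `S²ψ = 0`.

## Source

E. H. Lieb, *Two theorems on the Hubbard model*, Phys. Rev. Lett. 62 (1989) 1201–1204 (Erratum
62 (1989) 1927), Theorem 1 and its proof, eqs. (1)–(4) [LiebPRL1989]; read in the reprint
A. Montorsi (ed.), *The Hubbard Model — A Reprint Volume*, World Scientific (1992), [2.8].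
Secondary: H. Tasaki, *Physics and Mathematics of Quantum Many-Body Systems* (2020), §2.1
(variational principle), §9.2–9.3 (Jordan–Wigner fermions, Hubbard model, spin operators)
[Tasaki2020].
-/

namespace Literature.MathematicalPhysics.QuantumLattice

open Matrix Finset
open scoped ComplexOrder

/-! The auxiliary results live in the sub-namespace `Literature.Hubbard.LiebThm1` (the shared namespace
`Literature.Hubbard` is kept for the two discharges at the end of the file). -/

namespace LiebThm1

/-! ### Matrix elements of fermion bilinears (complements `FermionOperatorsProofs`) -/

section CAR

variable {ι : Type*} [LinearOrder ι] [Fintype ι]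

/-- Row action of `c_i`: `Σ_t (c_i)_{s,t} f t = [i ∉ s] · jwSign i s · f (s ∪ {i})`.
Bratteli–Robinson II §5.2.1. [cite: BratteliRobinsonII1997, §5.2.1] -/
theorem sum_annihilation_mul (i : ι) (s : Finset ι) (f : Finset ι → ℂ) :
    ∑ t, annihilation i s t * f t = if i ∉ s then jwSign i s * f (insert i s) else 0 := by
  by_cases hi : i ∈ s
  · rw [if_neg (not_not_intro hi)]
    refine Finset.sum_eq_zero fun t _ => ?_
    rw [annihilation_apply, if_neg (fun h => h.1 hi), zero_mul]
  · rw [if_pos hi, Finset.sum_eq_single (insert i s)]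
    · rw [annihilation_apply, if_pos ⟨hi, rfl⟩]
    · intro t _ ht
      rw [annihilation_apply, if_neg (fun h => ht h.2), zero_mul]
    · exact fun h => absurd (mem_univ _) h

/-- Row action of `c†_i`: `Σ_t (c†_i)_{s,t} f t = [i ∈ s] · jwSign i (s ∖ i) · f (s ∖ i)`.
Bratteli–Robinson II §5.2.1. [cite: BratteliRobinsonII1997, §5.2.1] -/
theorem sum_creation_mul (i : ι) (s : Finset ι) (f : Finset ι → ℂ) :
    ∑ t, creation i s t * f t = if i ∈ s then jwSign i (s.erase i) * f (s.erase i) else 0 := by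
  by_cases hi : i ∈ s
  · rw [if_pos hi, Finset.sum_eq_single (s.erase i)]
    · have h1 : i ∉ s.erase i ∧ s = insert i (s.erase i) :=
        ⟨notMem_erase i s, (insert_erase hi).symm⟩
      rw [creation_apply, if_pos h1]
    · intro t _ ht
      have : ¬(i ∉ t ∧ s = insert i t) := fun h => ht (by rw [h.2, erase_insert h.1])
      rw [creation_apply, if_neg this, zero_mul]
    · exact fun h => absurd (mem_univ _) h
  · rw [if_neg hi]
    refine Finset.sum_eq_zero fun t _ => ?_
    have : ¬(i ∉ t ∧ s = insert i t) := fun h => hi (h.2 ▸ mem_insert_self i t)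
    rw [creation_apply, if_neg this, zero_mul]

/-- `(c†_i M)_{s,u} = [i ∈ s] · jwSign i (s ∖ i) · M_{s ∖ i, u}`. Bratteli–Robinson II §5.2.1. [cite: BratteliRobinsonII1997, §5.2.1] -/
theorem creation_mul_apply (i : ι) (M : Matrix (Finset ι) (Finset ι) ℂ) (s u : Finset ι) :
    (creation i * M) s u = if i ∈ s then jwSign i (s.erase i) * M (s.erase i) u else 0 := by
  rw [Matrix.mul_apply, sum_creation_mul]

/-- The hopping operator on a wave function: `(c†_i c_j ψ)(s) = [i ∈ s, j ∉ s ∖ i] ·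
jwSign i (s ∖ i) · jwSign j (s ∖ i) · ψ ((s ∖ i) ∪ j)`. Tasaki (2020) §9.3.1. [cite: Tasaki2020, §9.3.1] -/
theorem creation_mul_annihilation_mulVec_apply (i j : ι) (ψ : Fock ι) (s : Finset ι) :
    ((creation i * annihilation j) *ᵥ ψ) s =
      if i ∈ s ∧ j ∉ s.erase i then
        jwSign i (s.erase i) * jwSign j (s.erase i) * ψ (insert j (s.erase i)) else 0 := by
  rw [← Matrix.mulVec_mulVec]
  show ∑ t, creation i s t * (annihilation j *ᵥ ψ) t = _
  rw [sum_creation_mul]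
  by_cases hi : i ∈ s
  · rw [if_pos hi, PosSemidefTrace.annihilation_mulVec_apply]
    by_cases hj : j ∉ s.erase i
    · rw [if_pos hj, if_pos ⟨hi, hj⟩, mul_assoc]
    · rw [if_neg hj, if_neg (fun h => hj h.2), mul_zero]
  · rw [if_neg hi, if_neg (fun h => hi h.1)]

/-- Entries of the hopping operator `c†_j c_i`. Bratteli–Robinson II §5.2.2. [cite: BratteliRobinsonII1997, §5.2.2] -/
theorem creation_mul_annihilation_apply (j i : ι) (s u : Finset ι) :
    (creation j * annihilation i) s u =
      if j ∈ s ∧ i ∉ s.erase j ∧ u = insert i (s.erase j) then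
        jwSign j (s.erase j) * jwSign i (s.erase j) else 0 := by
  rw [creation_mul_apply, annihilation_apply]
  by_cases hj : j ∈ s
  · rw [if_pos hj]
    by_cases h2 : i ∉ s.erase j ∧ u = insert i (s.erase j)
    · rw [if_pos h2, if_pos ⟨hj, h2⟩]
    · rw [if_neg h2, if_neg (fun h => h2 h.2), mul_zero]
  · rw [if_neg hj, if_neg (fun h => hj h.1)]

/-- `c_i c_i = 0` (Pauli principle for annihilators). Bratteli–Robinson II §5.2.2, (5.2.11). [cite: BratteliRobinsonII1997, §5.2.2] -/
theorem annihilation_mul_self (i : ι) : annihilation i * annihilation i = 0 := by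
  have h : (2 : ℂ) • (annihilation i * annihilation i) = 0 := by
    rw [two_smul]
    exact annihilation_anticommute_holds (ι := ι) i i
  exact (smul_eq_zero.1 h).resolve_left two_ne_zero

/-- `c_i c_j = - c_j c_i`. Bratteli–Robinson II §5.2.2, (5.2.11). [cite: BratteliRobinsonII1997, §5.2.2] -/
theorem annihilation_mul_annihilation_eq_neg (i j : ι) :
    annihilation i * annihilation j = -(annihilation j * annihilation i) :=
  eq_neg_of_add_eq_zero_left (annihilation_anticommute_holds i j)

/-- `c_i n_i = c_i`. Bratteli–Robinson II §5.2.2. [cite: BratteliRobinsonII1997, §5.2.2] -/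
theorem annihilation_mul_creation_mul_annihilation (i : ι) :
    annihilation i * creation i * annihilation i = annihilation i := by
  rw [annihilation_mul_creation, if_pos rfl, sub_mul, one_mul, mul_assoc, annihilation_mul_self,
    mul_zero, sub_zero]

/-- The commutator of two fermion bilinears:
`[c†_a c_b, c†_c c_d] = δ_bc c†_a c_d - δ_ad c†_c c_b` (consequence of the CAR; used for
`[H, S^±] = 0` and `[S⁺, S⁻] = 2 S^z`). Bratteli–Robinson II §5.2.2; Tasaki (2020) §9.3. [cite: BratteliRobinsonII1997, §5.2.2] -/
theorem creation_mul_annihilation_commutator (a b c d : ι) :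
    creation a * annihilation b * (creation c * annihilation d) -
        creation c * annihilation d * (creation a * annihilation b) =
      (if b = c then creation a * annihilation d else 0) -
        (if a = d then creation c * annihilation b else 0) := by
  have key : ∀ p q r w : ι,
      creation p * annihilation q * (creation r * annihilation w) =
        (if q = r then creation p * annihilation w else 0) +
          creation r * creation p * (annihilation q * annihilation w) := by
    intro p q r w
    calc creation p * annihilation q * (creation r * annihilation w)
        = creation p * (annihilation q * creation r) * annihilation w := by
          simp only [mul_assoc]
      _ = creation p * ((if q = r then (1 : Matrix (Finset ι) (Finset ι) ℂ) else 0) -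
            creation r * annihilation q) * annihilation w := by rw [annihilation_mul_creation]
      _ = creation p * (if q = r then (1 : Matrix (Finset ι) (Finset ι) ℂ) else 0) *
            annihilation w - creation p * creation r * (annihilation q * annihilation w) := by
          simp only [mul_sub, sub_mul, mul_assoc]
      _ = (if q = r then creation p * annihilation w else 0) +
            creation r * creation p * (annihilation q * annihilation w) := by
          rw [creation_mul_creation_eq_neg p r, neg_mul, sub_neg_eq_add]
          split_ifs
          · rw [mul_one]
          · rw [mul_zero, zero_mul]
  rw [key a b c d, key c d a b, annihilation_mul_annihilation_eq_neg d b, mul_neg,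
    creation_mul_creation_eq_neg c a, neg_mul]
  by_cases had : a = d
  · subst had
    simp only [if_true]
    abel
  · rw [if_neg had, if_neg (Ne.symm had)]
    abel

end CAR

/-! ### Lieb's sign `σ(α, β)` -/

section PairSign

variable {Λ : Type*} [LinearOrder Λ]

/-- `σ(α, δ ∪ x) = gtSign x α · σ(α, δ)`: adding a down electron at `x` flips the sign once for every
up electron above `x`. Tasaki (2020) §9.2.1 (Jordan–Wigner signs). [cite: Tasaki2020, §9.2.1] -/
theorem pairSign_insert_right (α : Finset Λ) {x : Λ} {δ : Finset Λ} (hx : x ∉ δ) :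
    pairSign α (insert x δ) = gtSign x α * pairSign α δ := by
  rw [pairSign, pairSign, gtSign]
  have : ∀ a ∈ α, jwSign a (insert x δ) = (if x < a then -1 else 1) * jwSign a δ := by
    intro a _
    rcases lt_trichotomy x a with h | rfl | h
    · rw [if_pos h, jwSign_insert_of_lt hx h, neg_one_mul]
    · rw [if_neg (lt_irrefl _), jwSign_insert_of_not_lt (lt_irrefl _), one_mul]
    · rw [if_neg (not_lt.2 h.le), jwSign_insert_of_not_lt (not_lt.2 h.le), one_mul]
  rw [prod_congr rfl this, prod_mul_distrib, prod_ite, prod_const, prod_const_one, mul_one]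

/-- `σ(α, β)` is a sign. Lieb, PRL 62 (1989) 1201, proof of Theorem 1 ("some arbitrary convention
for the sign"). [cite: LiebPRL1989, proof of Theorem 1] -/
theorem pairSign_mul_self (α β : Finset Λ) : pairSign α β * pairSign α β = 1 := by
  rw [pairSign, ← prod_mul_distrib]
  exact prod_eq_one fun a _ => jwSign_mul_self a β

/-- `σ(α, β)` is real. Lieb, PRL 62 (1989) 1201, proof of Theorem 1 (real basis vectors). [cite: LiebPRL1989, proof of Theorem 1] -/
theorem star_pairSign (α β : Finset Λ) : star (pairSign α β) = pairSign α β := by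
  rw [pairSign, star_prod]
  exact prod_congr rfl fun a _ => star_jwSign a β

/-- `σ(α, β) ≠ 0`. [folklore] -/
theorem pairSign_ne_zero (α β : Finset Λ) : pairSign α β ≠ 0 := fun h => by
  simpa [h] using pairSign_mul_self α β

end PairSign

/-! ### The hopping matrix: reality, symmetry, irreducibility -/

section HoppingMatrix

variable {Λ : Type*} [LinearOrder Λ] [Fintype Λ] {G : SimpleGraph Λ} [DecidableRel G.Adj]

/-- The matrix elements of `c†_x c_y` are `0` or `±1`, in particular real ("all operators and
basis vectors are real"). Lieb, PRL 62 (1989) 1201, proof of Theorem 1. [cite: LiebPRL1989, proof of Theorem 1] -/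
theorem star_creation_mul_annihilation_apply (x y : Λ) (s u : Finset Λ) :
    star ((creation x * annihilation y) s u) = (creation x * annihilation y) s u := by
  rw [creation_mul_annihilation_apply]
  split_ifs
  · rw [star_mul, star_jwSign, star_jwSign, mul_comm]
  · exact star_zero _

/-- The hopping matrix is real ("Clearly `K` is real ... since each `t_{xy}` is real").
Lieb, PRL 62 (1989) 1201, proof of Theorem 1. [cite: LiebPRL1989, proof of Theorem 1] -/
theorem star_hoppingMatrix_apply (t : ℝ) (s u : Finset Λ) :
    star (hoppingMatrix G t s u) = hoppingMatrix G t s u := by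
  rw [hoppingMatrix_apply, star_mul, star_neg, mul_comm]
  congr 1
  · rw [Complex.star_def, Complex.conj_ofReal]
  · rw [star_sum]
    refine Finset.sum_congr rfl fun x _ => ?_
    rw [star_sum]
    refine Finset.sum_congr rfl fun y _ => ?_
    split_ifs
    · exact star_creation_mul_annihilation_apply x y s u
    · exact star_zero _

/-- The hopping matrix is symmetric (real and Hermitian). Lieb, PRL 62 (1989) 1201, proof of
Theorem 1 ("`K` is real and symmetric"). [cite: LiebPRL1989, proof of Theorem 1] -/
theorem hoppingMatrix_transpose_apply (t : ℝ) (s u : Finset Λ) :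
    hoppingMatrix G t u s = hoppingMatrix G t s u := by
  conv_lhs => rw [← hoppingMatrix_conjTranspose, conjTranspose_apply, star_hoppingMatrix_apply]

/-- Lieb's `K` is Hermitian. Lieb, PRL 62 (1989) 1201, proof of Theorem 1. [cite: LiebPRL1989, proof of Theorem 1] -/
theorem liebK_conjTranspose (t : ℝ) (n : ℕ) : (liebK G t n)ᴴ = liebK G t n := by
  ext α β
  rw [conjTranspose_apply, liebK, liebK, star_hoppingMatrix_apply, hoppingMatrix_transpose_apply]

/-- Lieb's `K` is symmetric. Lieb, PRL 62 (1989) 1201, proof of Theorem 1 ("`K` is real and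
symmetric"). [cite: LiebPRL1989, proof of Theorem 1] -/
theorem liebK_symm (t : ℝ) (n : ℕ) (α β : Config Λ n) : liebK G t n β α = liebK G t n α β :=
  hoppingMatrix_transpose_apply t α.1 β.1

/-- Lieb's `K` is real. Lieb, PRL 62 (1989) 1201, proof of Theorem 1. [cite: LiebPRL1989, proof of Theorem 1] -/
theorem star_liebK (t : ℝ) (n : ℕ) (α β : Config Λ n) : star (liebK G t n α β) = liebK G t n α β :=
  star_hoppingMatrix_apply t α.1 β.1

/-- A hopping move has a nonzero hopping matrix element: for `y ∈ α`, `x ∉ α`, `x ∼ y`, the only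
term of `T` connecting `α` to `α - y + x` is `-t c†_x c_y`, with value `∓ t ≠ 0` (a bond is a pair
with `t_{xy} ≠ 0`). Lieb, PRL 62 (1989) 1201, proof of Theorem 1. [cite: LiebPRL1989, proof of Theorem 1] -/
theorem hoppingMatrix_hop_ne_zero {t : ℝ} (ht : t ≠ 0) {α : Finset Λ} {x y : Λ} (hxy : G.Adj x y)
    (hy : y ∈ α) (hx : x ∉ α) : hoppingMatrix G t (insert x (α.erase y)) α ≠ 0 := by
  set γ := insert x (α.erase y) with hγ
  have hxγ : γ.erase x = α.erase y := erase_insert fun h => hx (mem_of_mem_erase h)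
  have hαγ : α ≠ γ := fun h => hx (h ▸ mem_insert_self x _)
  -- the condition singles out `(x', y') = (x, y)`
  have key : ∀ x' y', (x' ∈ γ ∧ y' ∉ γ.erase x' ∧ α = insert y' (γ.erase x')) → x' = x ∧ y' = y := by
    rintro x' y' ⟨hx', hy', hα⟩
    have hx'y' : x' ≠ y' := by
      rintro rfl
      exact hαγ (by rw [hα, insert_erase hx'])
    have hx'α : x' ∉ α := by
      rw [hα, mem_insert]
      rintro (h | h)
      · exact hx'y' h
      · exact notMem_erase x' γ h
    have hx'x : x' = x := by
      rcases mem_insert.1 hx' with h | h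
      · exact h
      · exact absurd (mem_of_mem_erase h) hx'α
    subst hx'x
    refine ⟨rfl, ?_⟩
    rw [hxγ] at hα
    have : y ∈ insert y' (α.erase y) := hα ▸ hy
    rcases mem_insert.1 this with h | h
    · exact h.symm
    · exact absurd h (notMem_erase y α)
  rw [hoppingMatrix_apply, Finset.sum_eq_single x, Finset.sum_eq_single y, if_pos hxy,
    creation_mul_annihilation_apply,
    if_pos ⟨mem_insert_self x _, hxγ ▸ notMem_erase y α, by rw [hxγ, insert_erase hy]⟩]
  · have hj : ∀ (i : Λ) (s : Finset Λ), jwSign i s ≠ 0 := fun i s h => by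
      simpa [h] using jwSign_mul_self i s
    exact mul_ne_zero (neg_ne_zero.2 (Complex.ofReal_ne_zero.2 ht)) (mul_ne_zero (hj _ _) (hj _ _))
  · intro y' _ hy'
    rw [creation_mul_annihilation_apply, if_neg (fun h => hy' (key x y' h).2), ite_self]
  · exact fun h => absurd (mem_univ y) h
  · intro x' _ hx'
    refine Finset.sum_eq_zero fun y' _ => ?_
    rw [creation_mul_annihilation_apply, if_neg (fun h => hx' (key x' y' h).1), ite_self]
  · exact fun h => absurd (mem_univ x) h

/-- **Irreducibility.** On a connected graph with `t ≠ 0`, a subspace `Q` of `ℂ^{Config}` invariant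
under `K` and all `L_x` is `⊥` or `⊤`: the projectors `L^α = ∏_{x ∈ α} L_x` onto the basis vectors
map `Q` into `Q`, so `Q ≠ 0` contains some basis vector `μ^α`, and then every `μ^β` because the
`α`'s are connected by `K` (`reflTransGen_isHop`). Lieb, PRL 62 (1989) 1201, proof of Theorem 1
("Q contains a complete set of vectors"). [cite: LiebPRL1989, proof of Theorem 1] -/
theorem liebKL_irreducible (hG : G.Preconnected) {t : ℝ} (ht : t ≠ 0) (n : ℕ)
    (Q : Submodule ℂ (Config Λ n → ℂ)) (hK : ∀ v ∈ Q, liebK G t n *ᵥ v ∈ Q)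
    (hL : ∀ x, ∀ v ∈ Q, liebL n x *ᵥ v ∈ Q) : Q = ⊥ ∨ Q = ⊤ := by
  classical
  -- projectors: `v ↦ [S ⊆ α] v α` preserves `Q`
  have hproj : ∀ S : Finset Λ, ∀ v ∈ Q, (fun α : Config Λ n => if S ⊆ α.1 then v α else 0) ∈ Q := by
    intro S
    induction S using Finset.induction_on with
    | empty => intro v hv; simpa using hv
    | @insert x S hxS ih =>
      intro v hv
      have h1 := hL x _ (ih v hv)
      convert h1 using 1
      funext α
      rw [liebL_mulVec_apply]
      by_cases hx : x ∈ α.1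
      · by_cases hS : S ⊆ α.1
        · rw [if_pos (insert_subset hx hS), if_pos hx, if_pos hS]
        · rw [if_neg (fun h => hS ((subset_insert x S).trans h)), if_pos hx, if_neg hS]
      · rw [if_neg (fun h => hx (h (mem_insert_self x S))), if_neg hx]
  have hsingle : ∀ v ∈ Q, ∀ α : Config Λ n, Pi.single α (v α) ∈ Q := by
    intro v hv α
    convert hproj α.1 v hv using 1
    funext β
    by_cases hβ : β = α
    · subst hβ; simp
    · rw [Pi.single_eq_of_ne hβ, if_neg]
      exact fun h => hβ (Subtype.ext (eq_of_subset_of_card_le h (by rw [α.2, β.2])).symm)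
  have hbasis : ∀ v ∈ Q, ∀ α : Config Λ n, v α ≠ 0 → Pi.single α (1 : ℂ) ∈ Q := by
    intro v hv α hα
    have := Q.smul_mem (v α)⁻¹ (hsingle v hv α)
    rwa [← Pi.single_smul, smul_eq_mul, inv_mul_cancel₀ hα] at this
  -- hopping moves propagate basis vectors inside `Q`
  have hstep : ∀ α β : Config Λ n, IsHop G α.1 β.1 → Pi.single α (1 : ℂ) ∈ Q →
      Pi.single β (1 : ℂ) ∈ Q := by
    intro α β hαβ hα
    refine hbasis _ (hK _ hα) β ?_
    rw [mulVec_single_one]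
    obtain ⟨x, y, hxy, hy, hx, hβ⟩ := hαβ
    change hoppingMatrix G t β.1 α.1 ≠ 0
    rw [hβ]
    exact hoppingMatrix_hop_ne_zero ht hxy hy hx
  have hreach : ∀ α β : Config Λ n, Pi.single α (1 : ℂ) ∈ Q → Pi.single β (1 : ℂ) ∈ Q := by
    intro α β hα
    have h := reflTransGen_isHop hG (α.2.trans β.2.symm)
    -- induct along the chain of moves, keeping track of cardinalities
    suffices ∀ γ : Finset Λ, Relation.ReflTransGen (IsHop G) α.1 γ → ∀ hγ : γ.card = n,
        Pi.single (⟨γ, hγ⟩ : Config Λ n) (1 : ℂ) ∈ Q from this β.1 h β.2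
    intro γ hγ
    induction hγ with
    | refl => intro hγ; exact hα
    | @tail δ ε _ hδε ih =>
      intro hε
      have hδ : δ.card = n := by rw [← hδε.card_eq, hε]
      exact hstep ⟨δ, hδ⟩ ⟨ε, hε⟩ hδε (ih hδ)
  by_cases hQ : Q = ⊥
  · exact Or.inl hQ
  · right
    obtain ⟨v, hv, hv0⟩ := (Submodule.ne_bot_iff Q).1 hQ
    obtain ⟨α, hα⟩ : ∃ α, v α ≠ 0 := Function.ne_iff.1 hv0
    have hall : ∀ β : Config Λ n, Pi.single β (1 : ℂ) ∈ Q := fun β => hreach α β (hbasis v hv α hα)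
    rw [eq_top_iff]
    intro w _
    rw [show w = ∑ β, w β • Pi.single β (1 : ℂ) from by
      ext γ; simp [Finset.sum_apply, Pi.single_apply]]
    exact Q.sum_mem fun β _ => Q.smul_mem _ (hall β)

end HoppingMatrix

section HubbardSectors

variable {Λ : Type*} [LinearOrder Λ] [Fintype Λ]

/-! ### The Hubbard operators on sectors -/

/-- Up-spin hopping `c†_{x↑} c_{y↑}` conserves `N↑` and `N↓`. Lieb, PRL 62 (1989) 1201,
Remark (2)(i). [cite: LiebPRL1989, Remark (2)] -/
theorem preservesSectors_hopping_up (x y : Λ) :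
    PreservesSectors (creation (orb x 0) * annihilation (orb y 0) :
      Matrix (Finset (Orb Λ)) (Finset (Orb Λ)) ℂ) := by
  intro s s' h
  rw [creation_mul_annihilation_apply] at h
  split_ifs at h with hc
  · obtain ⟨hx, hy, rfl⟩ := hc
    obtain ⟨α, β, rfl⟩ : ∃ α β, s = pairSet α β :=
      ⟨upPart s, downPart s, (pairSet_upPart_downPart s).symm⟩
    rw [orb_zero_mem_pairSet] at hx
    rw [pairSet_erase_zero, orb_zero_mem_pairSet] at hy
    rw [pairSet_erase_zero, pairSet_insert_zero, upPart_pairSet, downPart_pairSet, upPart_pairSet,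
      downPart_pairSet, card_insert_of_notMem hy, card_erase_of_mem hx]
    exact ⟨(Nat.sub_add_cancel (card_pos.2 ⟨x, hx⟩)).symm, rfl⟩
  · exact absurd rfl h

/-- Down-spin hopping `c†_{x↓} c_{y↓}` conserves `N↑` and `N↓`. Lieb, PRL 62 (1989) 1201,
Remark (2)(i). [cite: LiebPRL1989, Remark (2)] -/
theorem preservesSectors_hopping_down (x y : Λ) :
    PreservesSectors (creation (orb x 1) * annihilation (orb y 1) :
      Matrix (Finset (Orb Λ)) (Finset (Orb Λ)) ℂ) := by
  intro s s' h
  rw [creation_mul_annihilation_apply] at h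
  split_ifs at h with hc
  · obtain ⟨hx, hy, rfl⟩ := hc
    obtain ⟨α, β, rfl⟩ : ∃ α β, s = pairSet α β :=
      ⟨upPart s, downPart s, (pairSet_upPart_downPart s).symm⟩
    rw [orb_one_mem_pairSet] at hx
    rw [pairSet_erase_one, orb_one_mem_pairSet] at hy
    rw [pairSet_erase_one, pairSet_insert_one, upPart_pairSet, downPart_pairSet, upPart_pairSet,
      downPart_pairSet, card_insert_of_notMem hy, card_erase_of_mem hx]
    exact ⟨rfl, (Nat.sub_add_cancel (card_pos.2 ⟨x, hx⟩)).symm⟩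
  · exact absurd rfl h

/-- Spin-conserving hopping `c†_{xσ} c_{yσ}` conserves `N↑` and `N↓`. Lieb, PRL 62 (1989) 1201,
Remark (2)(i). [cite: LiebPRL1989, Remark (2)] -/
theorem preservesSectors_hopping (x y : Λ) (σ : Fin 2) :
    PreservesSectors (creation (orb x σ) * annihilation (orb y σ) :
      Matrix (Finset (Orb Λ)) (Finset (Orb Λ)) ℂ) := by
  fin_cases σ
  · exact preservesSectors_hopping_up x y
  · exact preservesSectors_hopping_down x y

/-- `n_{xσ}` is diagonal in the occupation basis (`Literature.MathematicalPhysics.QuantumLattice.numberAt_eq_diagonal`).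
Tasaki (2020) §9.2. [cite: Tasaki2020, §9.2] -/
theorem numberOp_eq_diagonal (x : Λ) (σ : Fin 2) :
    (numberOp x σ : Matrix (Finset (Orb Λ)) (Finset (Orb Λ)) ℂ) =
      diagonal fun s => if orb x σ ∈ s then 1 else 0 :=
  Literature.MathematicalPhysics.QuantumLattice.numberAt_eq_diagonal (orb x σ)

/-- `n_{xσ}` conserves `N↑` and `N↓`. [folklore] -/
theorem preservesSectors_numberOp (x : Λ) (σ : Fin 2) :
    PreservesSectors (numberOp x σ : Matrix (Finset (Orb Λ)) (Finset (Orb Λ)) ℂ) := by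
  rw [numberOp_eq_diagonal]
  exact PreservesSectors.diagonal _

variable (G : SimpleGraph Λ) [DecidableRel G.Adj]

/-- The Hubbard Hamiltonian conserves both spin-up and spin-down particle numbers (so `S^z` and
`N` are conserved and `H` is block diagonal in the sectors `(N↑, N↓)`). Lieb, PRL 62 (1989) 1201,
proof of Theorem 1 ("`S²` and `S^z` are conserved") and Remark (2)(i). [cite: LiebPRL1989, proof of Theorem 1] -/
theorem preservesSectors_hamiltonian (t U : ℝ) : PreservesSectors (hamiltonian G t U) := by
  unfold hamiltonian
  refine PreservesSectors.add (PreservesSectors.smul (PreservesSectors.sum fun x _ =>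
    PreservesSectors.sum fun y _ => PreservesSectors.sum fun σ _ =>
      (preservesSectors_hopping x y σ).ite _) _) (PreservesSectors.smul
        (PreservesSectors.sum fun x _ =>
          (preservesSectors_numberOp x 0).mul (preservesSectors_numberOp x 1)) _)

end HubbardSectors

section Spin

variable {Λ : Type*} [LinearOrder Λ] [Fintype Λ]

/-! ### `S⁺`, `S⁻`, `S^z` on sectors -/

/-- The spin flip `c†_{x↑} c_{x↓}` raises `N↑` and lowers `N↓` by one. Lieb, PRL 62 (1989) 1201,
eq. (2). [cite: LiebPRL1989, eq. (2)] -/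
theorem raisesSpin_flip (x : Λ) :
    RaisesSpin (creation (orb x 0) * annihilation (orb x 1) :
      Matrix (Finset (Orb Λ)) (Finset (Orb Λ)) ℂ) := by
  intro s s' h
  rw [creation_mul_annihilation_apply] at h
  split_ifs at h with hc
  · obtain ⟨hx, hy, rfl⟩ := hc
    obtain ⟨α, β, rfl⟩ : ∃ α β, s = pairSet α β :=
      ⟨upPart s, downPart s, (pairSet_upPart_downPart s).symm⟩
    rw [orb_zero_mem_pairSet] at hx
    rw [pairSet_erase_zero, orb_one_mem_pairSet] at hy
    rw [pairSet_erase_zero, pairSet_insert_one, upPart_pairSet, downPart_pairSet, upPart_pairSet,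
      downPart_pairSet, card_insert_of_notMem hy, card_erase_of_mem hx]
    exact ⟨(Nat.sub_add_cancel (card_pos.2 ⟨x, hx⟩)).symm, rfl⟩
  · exact absurd rfl h

/-- `S⁺` maps the sector `(a, b + 1)` to `(a + 1, b)`. Lieb, PRL 62 (1989) 1201, eq. (2). [cite: LiebPRL1989, eq. (2)] -/
theorem raisesSpin_spinPlus : RaisesSpin (spinPlus : Matrix (Finset (Orb Λ)) (Finset (Orb Λ)) ℂ) :=
  RaisesSpin.sum fun x _ => raisesSpin_flip x

/-- `S⁻ = (S⁺)†` maps the sector `(a + 1, b)` to `(a, b + 1)`. Lieb, PRL 62 (1989) 1201, eq. (2). [cite: LiebPRL1989, eq. (2)] -/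
theorem lowersSpin_spinMinus :
    LowersSpin (Literature.MathematicalPhysics.QuantumLattice.spinMinus : Matrix (Finset (Orb Λ)) (Finset (Orb Λ)) ℂ) :=
  raisesSpin_spinPlus.conjTranspose

/-- `S^z = ½ Σ_x (n_{x↑} - n_{x↓})` is diagonal: `S^z |s⟩ = ½ (N↑(s) - N↓(s)) |s⟩`.
Lieb, PRL 62 (1989) 1201, eq. (2). [cite: LiebPRL1989, eq. (2)] -/
theorem spinZ_eq_diagonal :
    (HubbardWave0.spinZ : Matrix (Finset (Orb Λ)) (Finset (Orb Λ)) ℂ) =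
      diagonal fun s => (1 / 2 : ℂ) * (((upPart s).card : ℂ) - ((downPart s).card : ℂ)) := by
  ext s s'
  simp only [HubbardWave0.spinZ, numberOp_eq_diagonal, Matrix.smul_apply, Matrix.sum_apply, Matrix.sub_apply,
    diagonal_apply, smul_eq_mul]
  by_cases h : s = s'
  · subst h
    simp only [if_true]
    rw [Finset.sum_sub_distrib, Finset.sum_boole, Finset.sum_boole]
    rfl
  · simp [h]

/-- Components of `S^z ψ`. Lieb, PRL 62 (1989) 1201, eq. (2). [cite: LiebPRL1989, eq. (2)] -/
theorem spinZ_mulVec_apply (ψ : Fock (Orb Λ)) (s : Finset (Orb Λ)) :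
    (HubbardWave0.spinZ *ᵥ ψ) s = (1 / 2 : ℂ) * (((upPart s).card : ℂ) - ((downPart s).card : ℂ)) * ψ s := by
  rw [spinZ_eq_diagonal, mulVec_diagonal]

/-- On the sector `(a, b)`, `S^z = (a - b)/2`. Lieb, PRL 62 (1989) 1201, eq. (2) and proof of
Theorem 1 ("I work in the `S^z = 0` subspace"). [cite: LiebPRL1989, eq. (2)] -/
theorem spinZ_mulVec_of_isInSector {a b : ℕ} {ψ : Fock (Orb Λ)} (hψ : IsInSector a b ψ) :
    HubbardWave0.spinZ *ᵥ ψ = ((1 / 2 : ℂ) * ((a : ℂ) - (b : ℂ))) • ψ := by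
  funext s
  rw [spinZ_mulVec_apply, Pi.smul_apply, smul_eq_mul]
  by_cases hs : (upPart s).card = a ∧ (downPart s).card = b
  · rw [hs.1, hs.2]
  · rw [hψ s hs, mul_zero, mul_zero]

/-- The `su(2)` relation `[S⁺, S⁻] = 2 S^z` for the total spin of the Hubbard model (from the CAR;
this is the first half of `Literature.MathematicalPhysics.QuantumLattice.spin_su2_relations`). Tasaki (2020) §9.3, (9.3.6);
Lieb, PRL 62 (1989) 1201, eq. (2). [cite: Tasaki2020, §9.3] -/
theorem spinPlus_mul_spinMinus_sub :
    (spinPlus * Literature.MathematicalPhysics.QuantumLattice.spinMinus - Literature.MathematicalPhysics.QuantumLattice.spinMinus * spinPlus :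
      Matrix (Finset (Orb Λ)) (Finset (Orb Λ)) ℂ) = (2 : ℂ) • HubbardWave0.spinZ := by
  have key : ∀ x z : Λ,
      creation (orb x 0) * annihilation (orb x 1) * (creation (orb z 1) * annihilation (orb z 0)) -
        creation (orb z 1) * annihilation (orb z 0) * (creation (orb x 0) * annihilation (orb x 1)) =
      (if x = z then creation (orb x 0) * annihilation (orb z 0) else 0) -
        (if x = z then creation (orb z 1) * annihilation (orb x 1) else 0) := by
    intro x z
    rw [creation_mul_annihilation_commutator]
    simp only [Literature.MathematicalPhysics.QuantumLattice.orb_eq_orb_iff, and_true]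
  have h1 : (spinPlus * Literature.MathematicalPhysics.QuantumLattice.spinMinus : Matrix (Finset (Orb Λ)) (Finset (Orb Λ)) ℂ) =
      ∑ x, ∑ z, creation (orb x 0) * annihilation (orb x 1) *
        (creation (orb z 1) * annihilation (orb z 0)) := by
    rw [Literature.MathematicalPhysics.QuantumLattice.spinMinus_eq_sum, spinPlus, Finset.sum_mul_sum]
  have h2 : (Literature.MathematicalPhysics.QuantumLattice.spinMinus * spinPlus : Matrix (Finset (Orb Λ)) (Finset (Orb Λ)) ℂ) =
      ∑ x, ∑ z, creation (orb z 1) * annihilation (orb z 0) *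
        (creation (orb x 0) * annihilation (orb x 1)) := by
    rw [Literature.MathematicalPhysics.QuantumLattice.spinMinus_eq_sum, spinPlus, Finset.sum_mul_sum, Finset.sum_comm]
  rw [h1, h2, ← Finset.sum_sub_distrib]
  simp_rw [← Finset.sum_sub_distrib, key, Finset.sum_sub_distrib, Finset.sum_ite_eq,
    Finset.mem_univ, if_true]
  unfold HubbardWave0.spinZ numberOp
  rw [smul_smul]
  norm_num

end Spin

section Commutators

variable {Λ : Type*} [LinearOrder Λ] [Fintype Λ]

/-! ### `[H, S⁺] = 0` -/

/-- The spin-summed hopping term `Σ_σ c†_{xσ} c_{yσ}` commutes with `S⁺` (bilinear commutators: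
`[c†_{x↑}c_{y↑}, S⁺] = c†_{x↑}c_{y↓} = -[c†_{x↓}c_{y↓}, S⁺]`). Lieb, PRL 62 (1989) 1201
("the total spin `S` ... is a conserved quantity"); Tasaki (2020) §9.3. [cite: Tasaki2020, §9.3] -/
theorem sum_hopping_commute_spinPlus (x y : Λ) :
    Commute (∑ σ : Fin 2, creation (orb x σ) * annihilation (orb y σ))
      (spinPlus : Matrix (Finset (Orb Λ)) (Finset (Orb Λ)) ℂ) := by
  rw [Commute, SemiconjBy, spinPlus, Finset.mul_sum, Finset.sum_mul, ← sub_eq_zero,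
    ← Finset.sum_sub_distrib]
  simp_rw [Fin.sum_univ_two, Matrix.add_mul, Matrix.mul_add]
  have key : ∀ z : Λ,
      creation (orb x 0) * annihilation (orb y 0) * (creation (orb z 0) * annihilation (orb z 1)) +
          creation (orb x 1) * annihilation (orb y 1) * (creation (orb z 0) * annihilation (orb z 1)) -
        (creation (orb z 0) * annihilation (orb z 1) * (creation (orb x 0) * annihilation (orb y 0)) +
          creation (orb z 0) * annihilation (orb z 1) * (creation (orb x 1) * annihilation (orb y 1))) =
      (if y = z then creation (orb x 0) * annihilation (orb z 1) else 0) -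
        (if x = z then creation (orb z 0) * annihilation (orb y 1) else 0) := by
    intro z
    rw [add_sub_add_comm, creation_mul_annihilation_commutator,
      creation_mul_annihilation_commutator]
    simp only [Literature.MathematicalPhysics.QuantumLattice.orb_eq_orb_iff, and_true, Fin.isValue, zero_ne_one, and_false, if_false, sub_zero,
      one_ne_zero, zero_sub]
    abel
  simp_rw [key, Finset.sum_sub_distrib, Finset.sum_ite_eq, Finset.mem_univ, if_true, sub_self]

/-- The on-site interaction `n_{x↑} n_{x↓}` commutes with `S⁺` (`[AB, C] = A[B, C] + [A, C]B` with the
bilinear commutators, `n c† = c†`, `c n = c`). Lieb, PRL 62 (1989) 1201 (conservation of `S`);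
Tasaki (2020) §9.3. [cite: Tasaki2020, §9.3] -/
theorem numberOp_mul_numberOp_commute_spinPlus (x : Λ) :
    Commute (numberOp x 0 * numberOp x 1) (spinPlus : Matrix (Finset (Orb Λ)) (Finset (Orb Λ)) ℂ) := by
  rw [Commute, SemiconjBy, spinPlus, Finset.mul_sum, Finset.sum_mul, ← sub_eq_zero,
    ← Finset.sum_sub_distrib]
  have key : ∀ z : Λ,
      numberOp x 0 * numberOp x 1 * (creation (orb z 0) * annihilation (orb z 1)) -
        creation (orb z 0) * annihilation (orb z 1) * (numberOp x 0 * numberOp x 1) =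
      (0 : Matrix (Finset (Orb Λ)) (Finset (Orb Λ)) ℂ) := by
    intro z
    -- `[AB, C] = A [B, C] + [A, C] B`
    have hBC := creation_mul_annihilation_commutator (orb x 1) (orb x 1) (orb z 0) (orb z 1)
    have hAC := creation_mul_annihilation_commutator (orb x 0) (orb x 0) (orb z 0) (orb z 1)
    simp only [Literature.MathematicalPhysics.QuantumLattice.orb_eq_orb_iff, and_true, Fin.isValue, one_ne_zero, and_false, if_false, zero_sub,
      zero_ne_one, sub_zero] at hBC hAC
    have expand : numberOp x 0 * numberOp x 1 * (creation (orb z 0) * annihilation (orb z 1)) -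
        creation (orb z 0) * annihilation (orb z 1) * (numberOp x 0 * numberOp x 1) =
        numberOp x 0 * (numberOp x 1 * (creation (orb z 0) * annihilation (orb z 1)) -
          creation (orb z 0) * annihilation (orb z 1) * numberOp x 1) +
        (numberOp x 0 * (creation (orb z 0) * annihilation (orb z 1)) -
          creation (orb z 0) * annihilation (orb z 1) * numberOp x 0) * numberOp x 1 := by
      simp only [Matrix.mul_sub, Matrix.sub_mul, Matrix.mul_assoc]
      abel
    rw [expand]
    unfold numberOp
    rw [hBC, hAC]
    by_cases hxz : x = z
    · subst hxz
      simp only [if_true, Matrix.mul_neg, ← Matrix.mul_assoc, number_mul_creation_self]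
      rw [Matrix.mul_assoc (creation (orb x 0) * annihilation (orb x 1)),
        Matrix.mul_assoc (creation (orb x 0)), ← Matrix.mul_assoc (annihilation (orb x 1)),
        annihilation_mul_creation_mul_annihilation, neg_add_cancel]
    · simp [hxz]
  simp_rw [key, Finset.sum_const_zero]

variable (G : SimpleGraph Λ) [DecidableRel G.Adj]

/-- **`[H, S⁺] = 0`**: the Hubbard Hamiltonian commutes with the spin-raising operator.
Lieb, PRL 62 (1989) 1201 ("Of central importance is the total spin `S` which is a conserved
quantity"); Tasaki (2020) §9.3. [cite: LiebPRL1989, eq. (2)] -/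
theorem hamiltonian_commute_spinPlus (t U : ℝ) :
    Commute (hamiltonian G t U) (spinPlus : Matrix (Finset (Orb Λ)) (Finset (Orb Λ)) ℂ) := by
  unfold hamiltonian
  refine Commute.add_left (Commute.smul_left (Commute.sum_left _ _ _ fun x _ =>
    Commute.sum_left _ _ _ fun y _ => ?_) _)
    (Commute.smul_left (Commute.sum_left _ _ _ fun x _ =>
      numberOp_mul_numberOp_commute_spinPlus x) _)
  by_cases h : G.Adj x y
  · simp only [if_pos h]
    exact sum_hopping_commute_spinPlus x y
  · simp only [if_neg h, Finset.sum_const_zero]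
    exact Commute.zero_left _

/-- The Hubbard Hamiltonian is Hermitian (`t`, `U` real; the hopping sum over ordered pairs
contains each term with its adjoint; `n_{x↑}`, `n_{x↓}` are commuting Hermitian projections).
Lieb, PRL 62 (1989) 1201, eq. (1). [cite: LiebPRL1989, eq. (1)] -/
theorem hamiltonian_isHermitian (t U : ℝ) : (hamiltonian G t U).IsHermitian := by
  have hT : (∑ x : Λ, ∑ y : Λ, ∑ σ : Fin 2,
      (if G.Adj x y then creation (orb x σ) * annihilation (orb y σ)
        else (0 : Matrix (Finset (Orb Λ)) (Finset (Orb Λ)) ℂ)))ᴴ =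
      ∑ x : Λ, ∑ y : Λ, ∑ σ : Fin 2,
        (if G.Adj x y then creation (orb x σ) * annihilation (orb y σ) else 0) := by
    simp only [conjTranspose_sum]
    rw [Finset.sum_comm]
    refine Finset.sum_congr rfl fun a _ => Finset.sum_congr rfl fun b _ =>
      Finset.sum_congr rfl fun σ _ => ?_
    by_cases h : G.Adj a b
    · rw [if_pos h, if_pos h.symm, conjTranspose_mul, creation, creation,
        conjTranspose_conjTranspose]
    · rw [if_neg h, if_neg (fun h' => h h'.symm), conjTranspose_zero]
  have hV : (∑ x : Λ, (numberOp x 0 * numberOp x 1 : Matrix (Finset (Orb Λ)) (Finset (Orb Λ)) ℂ))ᴴ =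
      ∑ x : Λ, numberOp x 0 * numberOp x 1 := by
    rw [conjTranspose_sum]
    refine Finset.sum_congr rfl fun x _ => ?_
    rw [conjTranspose_mul]
    change (Literature.MathematicalPhysics.QuantumLattice.numberAt (orb x 1))ᴴ * (Literature.MathematicalPhysics.QuantumLattice.numberAt (orb x 0))ᴴ = _
    rw [(Literature.MathematicalPhysics.QuantumLattice.numberAt_isHermitian _).eq, (Literature.MathematicalPhysics.QuantumLattice.numberAt_isHermitian _).eq]
    exact (Literature.MathematicalPhysics.QuantumLattice.numberAt_commute _ _).eq
  unfold hamiltonian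
  rw [IsHermitian, conjTranspose_add, conjTranspose_smul, conjTranspose_smul, hT, hV]
  simp only [Complex.star_def, map_neg, Complex.conj_ofReal]

/-- **`[H, S⁻] = 0`** (adjoint of `[H, S⁺] = 0`). Lieb, PRL 62 (1989) 1201, eq. (2). [cite: LiebPRL1989, eq. (2)] -/
theorem hamiltonian_commute_spinMinus (t U : ℝ) :
    Commute (hamiltonian G t U) (Literature.MathematicalPhysics.QuantumLattice.spinMinus : Matrix (Finset (Orb Λ)) (Finset (Orb Λ)) ℂ) := by
  have h := hamiltonian_commute_spinPlus G t U
  rw [Commute, SemiconjBy] at h ⊢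
  have h' := congrArg conjTranspose h
  rw [conjTranspose_mul, conjTranspose_mul, (hamiltonian_isHermitian G t U).eq] at h'
  exact h'.symm

/-- `N = Σ n_{xσ}` is diagonal with eigenvalue `N↑(s) + N↓(s)` on `|s⟩`
(`Literature.MathematicalPhysics.QuantumLattice.totalNumberOp_eq_diagonal`). Tasaki (2020) §9.2. [cite: Tasaki2020, §9.2] -/
theorem totalNumber_eq_diagonal :
    (totalNumber : Matrix (Finset (Orb Λ)) (Finset (Orb Λ)) ℂ) =
      diagonal fun s => (((upPart s).card + (downPart s).card : ℕ) : ℂ) := by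
  rw [← Literature.MathematicalPhysics.QuantumLattice.totalNumberOp_eq_totalNumber, Literature.MathematicalPhysics.QuantumLattice.totalNumberOp_eq_diagonal]
  congr 1
  funext s
  rw [card_eq_upPart_add_downPart]

end Commutators

section Singlet

variable {Λ : Type*} [LinearOrder Λ] [Fintype Λ]

/-! ### Doubly occupied configurations are annihilated by `S⁺` and `S⁻` -/

/-- `S⁺` annihilates a fully paired configuration: the column of `S⁺` at `α↑ ∪ α↓` vanishes
(every down electron sits on a site whose up orbital is occupied). Lieb, PRL 62 (1989) 1201, proof
of Theorem 1 ("the vector `ψ^α ⊗ ψ^α` satisfies `(S_op)² φ = 0`"). [cite: LiebPRL1989, proof of Theorem 1] -/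
theorem spinPlus_apply_pairSet_self (s : Finset (Orb Λ)) (α : Finset Λ) :
    spinPlus s (pairSet α α) = 0 := by
  rw [spinPlus, Matrix.sum_apply]
  refine Finset.sum_eq_zero fun x _ => ?_
  rw [creation_mul_annihilation_apply, if_neg]
  rintro ⟨-, -, h⟩
  have h1 : orb x 1 ∈ pairSet α α := h ▸ mem_insert_self _ _
  have h2 : orb x 0 ∉ pairSet α α := by
    rw [h, mem_insert, mem_erase, Literature.MathematicalPhysics.QuantumLattice.orb_eq_orb_iff]
    simp
  rw [orb_one_mem_pairSet] at h1
  rw [orb_zero_mem_pairSet] at h2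
  exact h2 h1

/-- `S⁻` annihilates a fully paired configuration: the row of `S⁺` at `α↑ ∪ α↓` vanishes.
Lieb, PRL 62 (1989) 1201, proof of Theorem 1. [cite: LiebPRL1989, proof of Theorem 1] -/
theorem spinPlus_pairSet_self_apply (α : Finset Λ) (s : Finset (Orb Λ)) :
    spinPlus (pairSet α α) s = 0 := by
  rw [spinPlus, Matrix.sum_apply]
  refine Finset.sum_eq_zero fun x _ => ?_
  rw [creation_mul_annihilation_apply, if_neg]
  rintro ⟨h1, h2, -⟩
  rw [orb_zero_mem_pairSet] at h1
  exact h2 (mem_erase.2 ⟨by simp, by simpa using h1⟩)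

/-- `(S⁻ S⁺ ψ)(α↑ ∪ α↓) = 0` for every `ψ`. Lieb, PRL 62 (1989) 1201, proof of Theorem 1. [cite: LiebPRL1989, proof of Theorem 1] -/
theorem spinMinus_mul_spinPlus_mulVec_pairSet_self (ψ : Fock (Orb Λ)) (α : Finset Λ) :
    ((Literature.MathematicalPhysics.QuantumLattice.spinMinus * spinPlus) *ᵥ ψ) (pairSet α α) = 0 := by
  rw [← mulVec_mulVec, mulVec, dotProduct]
  refine Finset.sum_eq_zero fun s _ => ?_
  rw [Literature.MathematicalPhysics.QuantumLattice.spinMinus, conjTranspose_apply, spinPlus_apply_pairSet_self, star_zero,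
    zero_mul]

/-- `(S⁺ S⁻ ψ)(α↑ ∪ α↓) = 0` for every `ψ`. Lieb, PRL 62 (1989) 1201, proof of Theorem 1. [cite: LiebPRL1989, proof of Theorem 1] -/
theorem spinPlus_mul_spinMinus_mulVec_pairSet_self (ψ : Fock (Orb Λ)) (α : Finset Λ) :
    ((spinPlus * Literature.MathematicalPhysics.QuantumLattice.spinMinus) *ᵥ ψ) (pairSet α α) = 0 := by
  rw [← mulVec_mulVec, mulVec, dotProduct]
  refine Finset.sum_eq_zero fun s _ => ?_
  rw [spinPlus_pairSet_self_apply, zero_mul]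

end Singlet

section Norms

variable {ι : Type*} [Fintype ι]

/-! ### Norm identities -/

/-- `⟨ψ, Mᴴ M ψ⟩ = ⟨M ψ, M ψ⟩`. [folklore] -/
theorem star_dotProduct_conjTranspose_mul_mulVec (M : Matrix (Finset ι) (Finset ι) ℂ) (ψ : Fock ι) :
    star ψ ⬝ᵥ ((Mᴴ * M) *ᵥ ψ) = star (M *ᵥ ψ) ⬝ᵥ (M *ᵥ ψ) := by
  rw [← mulVec_mulVec, dotProduct_mulVec, star_mulVec]

/-- `⟨ψ, ψ⟩ = 0 ↔ ψ = 0` (Mathlib's `dotProduct_star_self_eq_zero`). [folklore] -/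
theorem star_dotProduct_self_eq_zero_iff (ψ : Fock ι) : star ψ ⬝ᵥ ψ = 0 ↔ ψ = 0 :=
  dotProduct_star_self_eq_zero

end Norms

section SpinNorms

variable {Λ : Type*} [LinearOrder Λ] [Fintype Λ]

/-- `‖S⁻ v‖² - ‖S⁺ v‖² = ⟨v, [S⁺, S⁻] v⟩ = (a - b) ‖v‖²` on the sector `(a, b)` ("the well known
properties of angular momentum"). Lieb, PRL 62 (1989) 1201, proof of Theorem 1; Tasaki (2020)
§9.3. [cite: LiebPRL1989, proof of Theorem 1] -/
theorem norm_spinMinus_sub_norm_spinPlus {a b : ℕ} {v : Fock (Orb Λ)} (hv : IsInSector a b v) :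
    star (Literature.MathematicalPhysics.QuantumLattice.spinMinus *ᵥ v) ⬝ᵥ (Literature.MathematicalPhysics.QuantumLattice.spinMinus *ᵥ v) -
        star (spinPlus *ᵥ v) ⬝ᵥ (spinPlus *ᵥ v) =
      ((a : ℂ) - (b : ℂ)) * (star v ⬝ᵥ v) := by
  have h1 : star (Literature.MathematicalPhysics.QuantumLattice.spinMinus *ᵥ v) ⬝ᵥ (Literature.MathematicalPhysics.QuantumLattice.spinMinus *ᵥ v) =
      star v ⬝ᵥ ((spinPlus * Literature.MathematicalPhysics.QuantumLattice.spinMinus) *ᵥ v) := by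
    rw [← star_dotProduct_conjTranspose_mul_mulVec]
    simp only [Literature.MathematicalPhysics.QuantumLattice.spinMinus, conjTranspose_conjTranspose]
  have h2 : star (spinPlus *ᵥ v) ⬝ᵥ (spinPlus *ᵥ v) =
      star v ⬝ᵥ ((Literature.MathematicalPhysics.QuantumLattice.spinMinus * spinPlus) *ᵥ v) := by
    rw [← star_dotProduct_conjTranspose_mul_mulVec, Literature.MathematicalPhysics.QuantumLattice.spinMinus]
  rw [h1, h2, ← dotProduct_sub, ← sub_mulVec, spinPlus_mul_spinMinus_sub, smul_mulVec,
    spinZ_mulVec_of_isInSector hv, smul_smul, dotProduct_smul, smul_eq_mul]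
  congr 1
  ring

/-- On a sector with more up than down electrons `S⁻` is injective (every state with `S^z > 0`
can be rotated down to `S^z = 0` without changing its energy: "all competitors have a
representative there"). Lieb, PRL 62 (1989) 1201, proof of Theorem 1. [cite: LiebPRL1989, proof of Theorem 1] -/
theorem eq_zero_of_spinMinus_mulVec_eq_zero {a b : ℕ} (hab : b < a) {v : Fock (Orb Λ)}
    (hv : IsInSector a b v) (h0 : Literature.MathematicalPhysics.QuantumLattice.spinMinus *ᵥ v = 0) : v = 0 := by
  have h := norm_spinMinus_sub_norm_spinPlus hv
  rw [h0, dotProduct_zero, zero_sub] at h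
  -- `-‖S⁺v‖² = (a - b) ‖v‖²` with `a - b > 0` forces `v = 0`
  have hnn : 0 ≤ star (spinPlus *ᵥ v) ⬝ᵥ (spinPlus *ᵥ v) := dotProduct_star_self_nonneg _
  have hvv : 0 ≤ star v ⬝ᵥ v := dotProduct_star_self_nonneg _
  have hab' : (0 : ℂ) < (a : ℂ) - (b : ℂ) := by
    rw [← Nat.cast_sub hab.le]; exact_mod_cast Nat.sub_pos_of_lt hab
  rw [← star_dotProduct_self_eq_zero_iff]
  by_contra hne
  have hpos : 0 < ((a : ℂ) - (b : ℂ)) * (star v ⬝ᵥ v) := mul_pos hab' (lt_of_le_of_ne hvv (Ne.symm hne))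
  rw [← h] at hpos
  exact absurd (neg_pos.1 hpos) hnn.not_gt

/-- On a sector with more down than up electrons `S⁺` is injective. Lieb, PRL 62 (1989) 1201,
proof of Theorem 1 ("all competitors have a representative there"). [cite: LiebPRL1989, proof of Theorem 1] -/
theorem eq_zero_of_spinPlus_mulVec_eq_zero {a b : ℕ} (hab : a < b) {v : Fock (Orb Λ)}
    (hv : IsInSector a b v) (h0 : spinPlus *ᵥ v = 0) : v = 0 := by
  have h := norm_spinMinus_sub_norm_spinPlus hv
  rw [h0, dotProduct_zero, sub_zero] at h
  have hnn : 0 ≤ star (Literature.MathematicalPhysics.QuantumLattice.spinMinus *ᵥ v) ⬝ᵥ (Literature.MathematicalPhysics.QuantumLattice.spinMinus *ᵥ v) :=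
    dotProduct_star_self_nonneg _
  have hvv : 0 ≤ star v ⬝ᵥ v := dotProduct_star_self_nonneg _
  have hab' : ((a : ℂ) - (b : ℂ)) < 0 := by
    rw [sub_neg]; exact_mod_cast hab
  rw [← star_dotProduct_self_eq_zero_iff]
  by_contra hne
  have hneg : ((a : ℂ) - (b : ℂ)) * (star v ⬝ᵥ v) < 0 :=
    mul_neg_of_neg_of_pos hab' (lt_of_le_of_ne hvv (Ne.symm hne))
  rw [← h] at hneg
  exact absurd hneg hnn.not_gt

end SpinNorms


section Variational

variable {ι : Type*} [Fintype ι]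

/-! ### The variational bound `E₀(N) ≤ ⟨ψ, H ψ⟩` -/

/-- A crude lower bound for the energy of a unit vector: `Re ⟨ψ, M ψ⟩ ≥ -Σ_{s,t} |M_{st}|` (finite
dimension). Tasaki (2020) §2.1 (variational characterisation of the ground-state energy). [cite: Tasaki2020, §2.1] -/
theorem neg_sum_norm_le_re_expect (M : Matrix (Finset ι) (Finset ι) ℂ) {ψ : Fock ι}
    (hψ : star ψ ⬝ᵥ ψ = 1) : -(∑ s, ∑ t, ‖M s t‖) ≤ (expect M ψ).re := by
  have hcomp : ∀ s, ‖ψ s‖ ≤ 1 := by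
    intro s
    have h1 : ‖ψ s‖ ^ 2 ≤ ∑ t, ‖ψ t‖ ^ 2 :=
      Finset.single_le_sum (fun t _ => sq_nonneg (‖ψ t‖)) (mem_univ s)
    have h2 : (∑ t, ‖ψ t‖ ^ 2 : ℝ) = 1 := by
      have := congrArg Complex.re hψ
      rw [dotProduct, Complex.re_sum] at this
      simp only [Pi.star_apply, Complex.star_def, Complex.conj_mul', Complex.one_re] at this
      rw [← this]
      refine Finset.sum_congr rfl fun t _ => ?_
      norm_cast
    rw [h2] at h1
    nlinarith [norm_nonneg (ψ s)]
  have hbound : ‖expect M ψ‖ ≤ ∑ s, ∑ t, ‖M s t‖ := by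
    rw [expect, dotProduct]
    refine (norm_sum_le _ _).trans (Finset.sum_le_sum fun s _ => ?_)
    rw [Pi.star_apply, norm_mul, norm_star, mulVec, dotProduct]
    refine (mul_le_of_le_one_left (norm_nonneg _) (hcomp s)).trans ?_
    refine (norm_sum_le _ _).trans (Finset.sum_le_sum fun t _ => ?_)
    rw [norm_mul]
    exact mul_le_of_le_one_right (norm_nonneg _) (hcomp t)
  have := Complex.abs_re_le_norm (expect M ψ)
  rw [abs_le] at this
  linarith [this.1]

/-- The set of energies `Re ⟨ψ, M ψ⟩` of unit `N`-particle vectors (whose infimum is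
`groundEnergy M N`) is bounded below. Tasaki (2020) §2.1. [cite: Tasaki2020, §2.1] -/
theorem bddBelow_energySet (M : Matrix (Finset ι) (Finset ι) ℂ) (N : ℕ) :
    BddBelow {E : ℝ | ∃ ψ : Fock ι, IsNParticle N ψ ∧ star ψ ⬝ᵥ ψ = 1 ∧ E = (expect M ψ).re} := by
  refine ⟨-(∑ s, ∑ t, ‖M s t‖), ?_⟩
  rintro E ⟨ψ, -, hψ, rfl⟩
  exact neg_sum_norm_le_re_expect M hψ

/-- **Variational principle**: `E₀(N) ≤ Re ⟨ψ, H ψ⟩` for every unit `N`-particle vector `ψ`.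
Tasaki (2020) §2.1, (2.1.6); Lieb, PRL 62 (1989) 1201 (ground states minimise the energy (3)). [cite: Tasaki2020, §2.1] -/
theorem groundEnergy_le_re_expect (M : Matrix (Finset ι) (Finset ι) ℂ) {N : ℕ} {ψ : Fock ι}
    (hN : IsNParticle N ψ) (hψ : star ψ ⬝ᵥ ψ = 1) : groundEnergy M N ≤ (expect M ψ).re :=
  csInf_le (bddBelow_energySet M N) ⟨ψ, hN, hψ, rfl⟩

/-- Homogeneous form of the variational principle: `E₀(N) ‖ψ‖² ≤ Re ⟨ψ, H ψ⟩` for every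
`N`-particle vector (normalise `ψ ≠ 0`). Tasaki (2020) §2.1. [cite: Tasaki2020, §2.1] -/
theorem groundEnergy_mul_norm_le (M : Matrix (Finset ι) (Finset ι) ℂ) {N : ℕ} {ψ : Fock ι}
    (hN : IsNParticle N ψ) : groundEnergy M N * (star ψ ⬝ᵥ ψ).re ≤ (expect M ψ).re := by
  by_cases h0 : ψ = 0
  · subst h0
    simp [expect]
  · have hpos : 0 < (star ψ ⬝ᵥ ψ).re := by
      have h1 : 0 < star ψ ⬝ᵥ ψ :=
        lt_of_le_of_ne (dotProduct_star_self_nonneg ψ)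
          (Ne.symm (mt dotProduct_star_self_eq_zero.1 h0))
      exact (Complex.pos_iff.1 h1).1
    set r : ℝ := (star ψ ⬝ᵥ ψ).re with hr
    have him : (star ψ ⬝ᵥ ψ).im = 0 :=
      (Complex.pos_iff.1 (lt_of_le_of_ne (dotProduct_star_self_nonneg ψ)
        (Ne.symm (mt dotProduct_star_self_eq_zero.1 h0)))).2.symm
    -- normalise
    set c : ℂ := (((Real.sqrt r)⁻¹ : ℝ) : ℂ) with hc
    have hcψN : IsNParticle N (c • ψ) := fun s hs => by simp [hN s hs]
    have hcc : star c * c = ((r⁻¹ : ℝ) : ℂ) := by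
      rw [hc, Complex.star_def, Complex.conj_ofReal, ← Complex.ofReal_mul, ← mul_inv,
        Real.mul_self_sqrt hpos.le]
    have hnorm : star (c • ψ) ⬝ᵥ (c • ψ) = 1 := by
      rw [star_smul, smul_dotProduct, dotProduct_smul, smul_smul, hcc, smul_eq_mul,
        show star ψ ⬝ᵥ ψ = (r : ℂ) from Complex.ext (by simp [hr]) (by simp [him]),
        ← Complex.ofReal_mul, inv_mul_cancel₀ hpos.ne', Complex.ofReal_one]
    have h := groundEnergy_le_re_expect M hcψN hnorm
    rw [expect, mulVec_smul, star_smul, smul_dotProduct, dotProduct_smul, smul_smul, hcc,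
      smul_eq_mul, Complex.re_ofReal_mul] at h
    change groundEnergy M N ≤ r⁻¹ * (expect M ψ).re at h
    rwa [le_inv_mul_iff₀ hpos, mul_comm] at h

end Variational


/-! ### The transfer `ψ ↦ W` is unitary on the `(n, n)` sector -/

section Transfer

variable {Λ : Type*} [LinearOrder Λ] [Fintype Λ]

/-- `W(liebVec W) = W`: every matrix is the coefficient matrix of a vector of the `(n, n)` sector.
Lieb, PRL 62 (1989) 1201, proof of Theorem 1. [cite: LiebPRL1989, proof of Theorem 1] -/
theorem liebW_liebVec (n : ℕ) (W : Matrix (Config Λ n) (Config Λ n) ℂ) : liebW n (liebVec n W) = W := by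
  ext α β
  rw [liebW_apply, liebVec]
  simp only [upPart_pairSet, downPart_pairSet]
  rw [dif_pos ⟨α.2, β.2⟩, ← mul_assoc, pairSign_mul_self, one_mul]

/-- `liebVec (W(ψ)) = ψ` on the `(n, n)` sector: `ψ = Σ W_{αβ} ψ^α_↑ ⊗ ψ^β_↓`.
Lieb, PRL 62 (1989) 1201, proof of Theorem 1. [cite: LiebPRL1989, proof of Theorem 1] -/
theorem liebVec_liebW {n : ℕ} {ψ : Fock (Orb Λ)} (hψ : IsInSector n n ψ) : liebVec n (liebW n ψ) = ψ := by
  funext s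
  rw [liebVec]
  split_ifs with h
  · rw [liebW_apply]
    simp only [pairSet_upPart_downPart]
    rw [← mul_assoc, pairSign_mul_self, one_mul]
  · exact (hψ s h).symm

/-- `ψ ↦ W(ψ)` is injective on the `(n, n)` sector. Lieb, PRL 62 (1989) 1201, proof of Theorem 1. [cite: LiebPRL1989, proof of Theorem 1] -/
theorem liebW_eq_zero_iff {n : ℕ} {ψ : Fock (Orb Λ)} (hψ : IsInSector n n ψ) : liebW n ψ = 0 ↔ ψ = 0 := by
  constructor
  · intro h
    rw [← liebVec_liebW hψ, h]
    funext s
    simp [liebVec]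
  · rintro rfl
    exact liebW_zero n

/-- `W_{αα} ≠ 0` iff `ψ` has nonzero amplitude on the fully paired configuration `α↑ ∪ α↓`
(nonzero projection onto `ψ^α_↑ ⊗ ψ^α_↓`, an `S = 0` state). Lieb, PRL 62 (1989) 1201, proof of
Theorem 1. [cite: LiebPRL1989, proof of Theorem 1] -/
theorem liebW_apply_self_ne_zero_iff (n : ℕ) (ψ : Fock (Orb Λ)) (α : Config Λ n) :
    liebW n ψ α α ≠ 0 ↔ ψ (pairSet α.1 α.1) ≠ 0 := by
  rw [liebW_apply, mul_ne_zero_iff, and_iff_right (pairSign_ne_zero _ _)]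

/-- The transfer is unitary: `⟨W(ψ), W(φ)⟩_HS = ⟨ψ, φ⟩` for `ψ` in the `(n, n)` sector ("The norm
of `ψ` squared is `⟨ψ|ψ⟩ = Σ |W_{αβ}|² = Tr W²`"). Lieb, PRL 62 (1989) 1201, proof of Theorem 1. [cite: LiebPRL1989, proof of Theorem 1] -/
theorem hsInner_liebW {n : ℕ} {ψ : Fock (Orb Λ)} (hψ : IsInSector n n ψ) (φ : Fock (Orb Λ)) :
    hsInner (liebW n ψ) (liebW n φ) = star ψ ⬝ᵥ φ := by
  have key : ∀ α β : Finset Λ,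
      star (pairSign α β * ψ (pairSet α β)) * (pairSign α β * φ (pairSet α β)) =
        star (ψ (pairSet α β)) * φ (pairSet α β) := by
    intro α β
    rw [star_mul, star_pairSign]
    linear_combination (star (ψ (pairSet α β)) * φ (pairSet α β)) * pairSign_mul_self α β
  have hvan : ∀ α β : Finset Λ, ¬(α.card = n ∧ β.card = n) →
      star (ψ (pairSet α β)) * φ (pairSet α β) = 0 := by
    intro α β h
    rw [hψ _ (fun h' => h (by simpa using h')), star_zero, zero_mul]
  calc hsInner (liebW n ψ) (liebW n φ)
      = ∑ α : Config Λ n, ∑ β : Config Λ n, star (ψ (pairSet α.1 β.1)) * φ (pairSet α.1 β.1) := by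
        rw [hsInner_apply]
        exact Finset.sum_congr rfl fun α _ => Finset.sum_congr rfl fun β _ => key α.1 β.1
    _ = ∑ α : Finset Λ, ∑ β : Finset Λ, star (ψ (pairSet α β)) * φ (pairSet α β) := by
        rw [sum_config_eq_sum n (fun α => ∑ β : Config Λ n, star (ψ (pairSet α β.1)) * φ (pairSet α β.1))]
        · refine Finset.sum_congr rfl fun α _ => ?_
          exact sum_config_eq_sum n (fun β => star (ψ (pairSet α β)) * φ (pairSet α β))
            fun β hβ => hvan α β fun h => hβ h.2
        · intro α hα
          exact Finset.sum_eq_zero fun β _ => hvan α β.1 fun h => hα h.1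
    _ = ∑ p : Finset Λ × Finset Λ, star (ψ (pairSet p.1 p.2)) * φ (pairSet p.1 p.2) :=
        (Fintype.sum_prod_type' _).symm
    _ = ∑ s : Finset (Orb Λ), star (ψ s) * φ s := by
        refine Fintype.sum_equiv configEquiv.symm _ _ fun p => ?_
        rfl
    _ = star ψ ⬝ᵥ φ := rfl

end Transfer

/-! ### Transfer of the Hamiltonian: `W(Hψ) = K W + W K + U Σ_x L_x W L_x` -/

section TransferH

variable {Λ : Type*} [LinearOrder Λ] [Fintype Λ]

/-- Jordan–Wigner sign of a down orbital in the form `(-1)^{#α} · gtSign x α · jwSign x δ`.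
Tasaki (2020) §9.2.1. [cite: Tasaki2020, §9.2.1] -/
theorem jwSign_orb_one' (α δ : Finset Λ) (x : Λ) :
    jwSign (orb x 1) (pairSet α δ) = (-1) ^ α.card * gtSign x α * jwSign x δ := by
  rw [jwSign_orb_one, ← leSign_mul_gtSign x α, mul_assoc, mul_assoc, ← mul_assoc (gtSign x α),
    gtSign_mul_self, one_mul]

/-- Up-spin hopping acts on the coefficient matrix from the left, `W(c†_{x↑} c_{y↑} ψ) = T_{xy} W(ψ)`
with `T_{xy}` the spinless `c†_x c_y` on `n`-subsets: the Jordan–Wigner signs of the down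
electrons are absorbed by `σ(α, β)`. Lieb, PRL 62 (1989) 1201, eqs. (3)–(4) (the term `K W`). [cite: LiebPRL1989, eq. (4)] -/
theorem liebW_hopping_up_mulVec (n : ℕ) (x y : Λ) (ψ : Fock (Orb Λ)) :
    liebW n ((creation (orb x 0) * annihilation (orb y 0)) *ᵥ ψ) = configHop n x y * liebW n ψ := by
  ext α β
  rw [liebW_apply, creation_mul_annihilation_mulVec_apply, Matrix.mul_apply]
  simp only [orb_zero_mem_pairSet, pairSet_erase_zero, pairSet_insert_zero, jwSign_orb_zero,
    configHop, liebW_apply, creation_mul_annihilation_apply]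
  by_cases hc : x ∈ α.1 ∧ y ∉ α.1.erase x
  · obtain ⟨hx, hy⟩ := hc
    have hcard : (insert y (α.1.erase x)).card = n := by
      rw [card_insert_of_notMem hy, card_erase_of_mem hx]
      have h1 := α.2
      have h2 := card_pos.2 ⟨x, hx⟩
      omega
    rw [if_pos ⟨hx, hy⟩, Finset.sum_eq_single ⟨insert y (α.1.erase x), hcard⟩]
    · rw [if_pos ⟨hx, hy, rfl⟩]
      set γ := α.1.erase x with hγ
      have hxγ : x ∉ γ := notMem_erase x α.1
      rw [show pairSign α.1 β.1 = jwSign x β.1 * pairSign γ β.1 by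
        rw [← pairSign_insert_left hxγ, hγ, insert_erase hx], pairSign_insert_left hy]
      linear_combination (jwSign x γ * jwSign y γ * jwSign y β.1 * pairSign γ β.1 *
        ψ (pairSet (insert y γ) β.1)) * jwSign_mul_self x β.1
    · intro α' _ hα'
      rw [if_neg, zero_mul]
      rintro ⟨-, -, h⟩
      exact hα' (Subtype.ext h)
    · exact fun h => absurd (mem_univ _) h
  · rw [if_neg hc, mul_zero]
    refine (Finset.sum_eq_zero fun α' _ => ?_).symm
    rw [if_neg (fun h => hc ⟨h.1, h.2.1⟩), zero_mul]

/-- Down-spin hopping acts on the coefficient matrix from the right,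
`W(c†_{x↓} c_{y↓} ψ) = W(ψ) T_{xy}ᵀ`. Lieb, PRL 62 (1989) 1201, eqs. (3)–(4) (the term `W K`;
"the Hamiltonian is symmetric between the up and the down spins"). [cite: LiebPRL1989, eq. (4)] -/
theorem liebW_hopping_down_mulVec (n : ℕ) (x y : Λ) (ψ : Fock (Orb Λ)) :
    liebW n ((creation (orb x 1) * annihilation (orb y 1)) *ᵥ ψ) = liebW n ψ * (configHop n x y)ᵀ := by
  ext α β
  rw [liebW_apply, creation_mul_annihilation_mulVec_apply, Matrix.mul_apply]
  simp only [orb_one_mem_pairSet, pairSet_erase_one, pairSet_insert_one, jwSign_orb_one',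
    configHop, liebW_apply, creation_mul_annihilation_apply, transpose_apply]
  by_cases hc : x ∈ β.1 ∧ y ∉ β.1.erase x
  · obtain ⟨hx, hy⟩ := hc
    have hcard : (insert y (β.1.erase x)).card = n := by
      rw [card_insert_of_notMem hy, card_erase_of_mem hx]
      have h1 := β.2
      have h2 := card_pos.2 ⟨x, hx⟩
      omega
    rw [if_pos ⟨hx, hy⟩, Finset.sum_eq_single ⟨insert y (β.1.erase x), hcard⟩]
    · rw [if_pos ⟨hx, hy, rfl⟩]
      set δ := β.1.erase x with hδ
      have hxδ : x ∉ δ := notMem_erase x β.1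
      rw [show pairSign α.1 β.1 = gtSign x α.1 * pairSign α.1 δ by
        rw [← pairSign_insert_right α.1 hxδ, hδ, insert_erase hx], pairSign_insert_right α.1 hy]
      have he : ((-1) ^ α.1.card : ℂ) * (-1) ^ α.1.card = 1 := by
        rw [← mul_pow, neg_mul_neg, one_mul, one_pow]
      linear_combination (pairSign α.1 δ * jwSign x δ * jwSign y δ * gtSign y α.1 *
          ψ (pairSet α.1 (insert y δ)) * (-1) ^ α.1.card * (-1) ^ α.1.card) * gtSign_mul_self x α.1 +
        (pairSign α.1 δ * jwSign x δ * jwSign y δ * gtSign y α.1 * ψ (pairSet α.1 (insert y δ))) * he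
    · intro β' _ hβ'
      rw [if_neg, mul_zero]
      rintro ⟨-, -, h⟩
      exact hβ' (Subtype.ext h)
    · exact fun h => absurd (mem_univ _) h
  · rw [if_neg hc, mul_zero]
    refine (Finset.sum_eq_zero fun β' _ => ?_).symm
    rw [if_neg (fun h => hc ⟨h.1, h.2.1⟩), mul_zero]

/-- The on-site interaction acts as `W(n_{x↑} n_{x↓} ψ) = L_x W(ψ) L_x`. Lieb, PRL 62 (1989) 1201,
eqs. (3)–(4) (the term `Σ_x U_x L_x W L_x`). [cite: LiebPRL1989, eq. (4)] -/
theorem liebW_numberOp_mul_numberOp_mulVec (n : ℕ) (x : Λ) (ψ : Fock (Orb Λ)) :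
    liebW n ((numberOp x 0 * numberOp x 1) *ᵥ ψ) = liebL n x * liebW n ψ * liebL n x := by
  ext α β
  rw [liebW_apply, numberOp_eq_diagonal, numberOp_eq_diagonal, diagonal_mul_diagonal,
    mulVec_diagonal, liebL, mul_diagonal, diagonal_mul, liebW_apply]
  simp only [orb_zero_mem_pairSet, orb_one_mem_pairSet, mul_ite, mul_one, mul_zero, ite_mul,
    one_mul, zero_mul]

variable (G : SimpleGraph Λ) [DecidableRel G.Adj]

/-- `Kᵀ = K`. Lieb, PRL 62 (1989) 1201, proof of Theorem 1 ("`K` is real and symmetric"). [cite: LiebPRL1989, proof of Theorem 1] -/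
theorem liebK_transpose (t : ℝ) (n : ℕ) : (liebK G t n)ᵀ = liebK G t n := by
  ext α β
  rw [transpose_apply]
  exact liebK_symm (G := G) t n α β

/-- **Transfer of the Hamiltonian** (Lieb's eq. (4)): on coefficient matrices the Hubbard
Hamiltonian acts as `W(H ψ) = K W(ψ) + W(ψ) K + U Σ_x L_x W(ψ) L_x = 𝓗 (W ψ)`, with `K = liebK G t n`
(real symmetric, so `W Kᵀ = W K`) and `L_x = liebL n x`. Lieb, PRL 62 (1989) 1201, eq. (4). [cite: LiebPRL1989, eq. (4)] -/
theorem liebW_hamiltonian_mulVec (t U : ℝ) (n : ℕ) (ψ : Fock (Orb Λ)) :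
    liebW n (hamiltonian G t U *ᵥ ψ) = liebOp (liebK G t n) (liebL n) U (liebW n ψ) := by
  have hhop : ∀ x y : Λ, liebW n ((∑ σ : Fin 2, if G.Adj x y then
      creation (orb x σ) * annihilation (orb y σ) else 0) *ᵥ ψ) =
      (if G.Adj x y then configHop n x y else 0) * liebW n ψ +
        liebW n ψ * (if G.Adj x y then configHop n x y else 0)ᵀ := by
    intro x y
    by_cases h : G.Adj x y
    · simp only [if_pos h, Fin.sum_univ_two, add_mulVec, liebW_add, liebW_hopping_up_mulVec,
        liebW_hopping_down_mulVec]
    · simp only [if_neg h, Finset.sum_const_zero, zero_mulVec, liebW_zero, Matrix.zero_mul,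
        transpose_zero, Matrix.mul_zero, add_zero]
  set A : Matrix (Config Λ n) (Config Λ n) ℂ := ∑ x : Λ, ∑ y : Λ,
    if G.Adj x y then configHop n x y else 0 with hA
  have hhop' : ∀ x y : Λ, ∑ σ : Fin 2, liebW n ((if G.Adj x y then
      creation (orb x σ) * annihilation (orb y σ) else (0 : Matrix _ _ ℂ)) *ᵥ ψ) =
      (if G.Adj x y then configHop n x y else 0) * liebW n ψ +
        liebW n ψ * (if G.Adj x y then configHop n x y else 0)ᵀ := by
    intro x y
    have := hhop x y
    rwa [sum_mulVec, liebW_sum] at this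
  have hT : liebW n ((∑ x : Λ, ∑ y : Λ, ∑ σ : Fin 2, if G.Adj x y then
      creation (orb x σ) * annihilation (orb y σ) else (0 : Matrix _ _ ℂ)) *ᵥ ψ) =
      A * liebW n ψ + liebW n ψ * Aᵀ := by
    simp only [sum_mulVec, liebW_sum, hhop', Finset.sum_add_distrib, hA, transpose_sum,
      Matrix.sum_mul, Matrix.mul_sum]
  have hV : liebW n ((∑ x : Λ, (numberOp x 0 * numberOp x 1 : Matrix _ _ ℂ)) *ᵥ ψ) =
      ∑ x, liebL n x * liebW n ψ * liebL n x := by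
    simp only [sum_mulVec, liebW_sum, liebW_numberOp_mul_numberOp_mulVec]
  have hK : liebK G t n = -(t : ℂ) • A := liebK_eq_sum (G := G) t n
  unfold hamiltonian
  rw [add_mulVec, smul_mulVec, smul_mulVec, liebW_add, liebW_smul, liebW_smul, hT, hV, liebOp]
  conv_rhs => rw [show liebW n ψ * liebK G t n = liebW n ψ * (liebK G t n)ᵀ by
    rw [liebK_transpose]]
  rw [hK, transpose_smul, Matrix.smul_mul, Matrix.mul_smul, smul_add]

end TransferH

section Core

variable {Λ : Type*} [LinearOrder Λ] [Fintype Λ] (G : SimpleGraph Λ) [DecidableRel G.Adj]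

/-- The attractive Hubbard model in the `(n, n)` sector satisfies the hypotheses `IsLiebSystem` of the
matrix argument: `K`, `L_x` Hermitian, `U < 0`, the variational bound transferred along the unitary
`ψ ↦ W` (`E ‖W‖² ≤ Re ⟨W, 𝓗 W⟩` from `E ‖φ‖² ≤ Re ⟨φ, H φ⟩` on the sector), and irreducibility
from the connectivity of `G` and `t ≠ 0`. Lieb, PRL 62 (1989) 1201, proof of Theorem 1. [cite: LiebPRL1989, proof of Theorem 1] -/
theorem isLiebSystem_hubbard (hG : G.Connected) {t U : ℝ} (ht : t ≠ 0) (hU : U < 0) (n : ℕ)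
    {E : ℝ} (hE : ∀ φ : Fock (Orb Λ), IsInSector n n φ →
      E * (star φ ⬝ᵥ φ).re ≤ (expect (hamiltonian G t U) φ).re) :
    IsLiebSystem (liebK G t n) (liebL n) U E where
  K_herm := liebK_conjTranspose t n
  L_herm := liebL_conjTranspose n
  U_neg := hU
  energy_le := by
    intro Z
    set φ := liebVec n Z with hφdef
    have hφ : IsInSector n n φ := isInSector_liebVec n Z
    have hZ : Z = liebW n φ := (liebW_liebVec n Z).symm
    rw [hZ, ← liebW_hamiltonian_mulVec, hsInner_liebW hφ, hsInner_liebW hφ]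
    exact hE φ hφ
  irred := fun Q hK hL => liebKL_irreducible hG.preconnected ht n Q hK hL

/-- **Lieb's Theorem 1(b) in the `S^z = 0` sector.** For the attractive (`U < 0`) Hubbard model on a
connected graph with `t ≠ 0`: in the `(n, n)` sector, eigenvectors of `H` at an energy `E` that
bounds the quadratic form of `H` on the sector from below (the sector ground states) are unique
up to scalars, and a nonzero one has nonzero amplitude on every fully paired configuration
`α↑ ∪ α↓` (nonzero projection onto the `S = 0` states `ψ^α_↑ ⊗ ψ^α_↓`). Lieb, PRL 62 (1989)
1201, Theorem 1 and its proof. [cite: LiebPRL1989, Theorem 1] -/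
theorem lieb_core (hG : G.Connected) {t U : ℝ} (ht : t ≠ 0) (hU : U < 0) (n : ℕ) {E : ℝ}
    (hE : ∀ φ : Fock (Orb Λ), IsInSector n n φ →
      E * (star φ ⬝ᵥ φ).re ≤ (expect (hamiltonian G t U) φ).re) :
    (∀ ψ₁ ψ₂ : Fock (Orb Λ), IsInSector n n ψ₁ → IsInSector n n ψ₂ →
        hamiltonian G t U *ᵥ ψ₁ = (E : ℂ) • ψ₁ → hamiltonian G t U *ᵥ ψ₂ = (E : ℂ) • ψ₂ →
        ψ₁ ≠ 0 → ∃ c : ℂ, ψ₂ = c • ψ₁) ∧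
      ∀ ψ : Fock (Orb Λ), IsInSector n n ψ → hamiltonian G t U *ᵥ ψ = (E : ℂ) • ψ → ψ ≠ 0 →
        ∀ α : Config Λ n, ψ (pairSet α.1 α.1) ≠ 0 := by
  have S := isLiebSystem_hubbard G hG ht hU n hE
  have hgs : ∀ ψ : Fock (Orb Λ), hamiltonian G t U *ᵥ ψ = (E : ℂ) • ψ →
      liebOp (liebK G t n) (liebL n) U (liebW n ψ) = (E : ℂ) • liebW n ψ := by
    intro ψ hψ
    rw [← liebW_hamiltonian_mulVec, hψ, liebW_smul]
  refine ⟨fun ψ₁ ψ₂ h₁ h₂ e₁ e₂ hne => ?_, fun ψ hψ e hne α => ?_⟩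
  · have hW₁ : liebW n ψ₁ ≠ 0 := fun h => hne ((liebW_eq_zero_iff h₁).1 h)
    obtain ⟨c, hc⟩ := S.exists_eq_smul (hgs ψ₁ e₁) (hgs ψ₂ e₂) hW₁
    refine ⟨c, ?_⟩
    rw [← sub_eq_zero, ← liebW_eq_zero_iff (h₂.sub (h₁.smul c)), liebW_sub, liebW_smul, hc,
      sub_self]
  · have hW : liebW n ψ ≠ 0 := fun h => hne ((liebW_eq_zero_iff hψ).1 h)
    exact (liebW_apply_self_ne_zero_iff n ψ α).1 (S.apply_self_ne_zero (hgs ψ e) hW α)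

end Core

end LiebThm1

/-! ### The discharges -/

section Discharges

open LiebThm1

variable {Λ : Type*} [LinearOrder Λ] [Fintype Λ] (G : SimpleGraph Λ) [DecidableRel G.Adj]

/-- **Discharge** of `hamiltonian_isHermitian_and_commute` (hubbard.S05): the Hubbard Hamiltonian
is Hermitian and conserves `N` and `S^z` (it is block diagonal in the sectors `(N↑, N↓)`, and `N`,
`S^z` are functions of the sector). Lieb, arXiv:cond-mat/9311033 §2; Lieb, PRL 62 (1989) 1201,
eqs. (1)–(2). [cite: LiebPRL1989, eqs. (1)–(2)] -/
theorem hamiltonian_isHermitian_and_commute_holds : hamiltonian_isHermitian_and_commute G := by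
  intro t U
  refine ⟨hamiltonian_isHermitian G t U, ?_, ?_⟩
  · rw [totalNumber_eq_diagonal]
    exact (preservesSectors_hamiltonian G t U).commute_diagonal fun a b => ((a + b : ℕ) : ℂ)
  · rw [spinZ_eq_diagonal]
    exact (preservesSectors_hamiltonian G t U).commute_diagonal
      fun a b => (1 / 2 : ℂ) * ((a : ℂ) - (b : ℂ))

/-! ### Assembly: all ground states lie in the `S^z = 0` sector and are singlets -/

/-- **Discharge** of `lieb_attractive` (hubbard.S09; Lieb's Theorem 1(b), attractive case): for
`U < 0`, `t ≠ 0`, `G` connected and `N = 2n` even, the ground state of the Hubbard Hamiltonian in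
the `N`-particle sector is unique up to a scalar and satisfies `S² ψ = 0`.
Proof (Lieb, with the `SU(2)` bookkeeping made explicit): `H` conserves `(N↑, N↓)` and commutes
with `S^±`, so each sector component of a ground state is an eigenvector at `E₀ = groundEnergy`;
in the `(n, n)` sector `lieb_core` gives uniqueness and nonvanishing paired amplitudes, whence
`S⁺ψ₀ = S⁻ψ₀ = 0` there (`S⁻S⁺ψ₀ ∝ ψ₀` vanishes on paired configurations); components in
sectors `(a, b)` with `a ≠ b` vanish by lowering/raising them step by step into the `(n, n)`
sector (`S⁻`, resp. `S⁺`, is injective there by `‖S⁻v‖² - ‖S⁺v‖² = (a - b)‖v‖²`). Hence every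
ground state lies in the `(n, n)` sector, is unique up to scalars, and
`S²ψ = (S^z)²ψ + ½(S⁺S⁻ + S⁻S⁺)ψ = 0`. Lieb, PRL 62 (1989) 1201, Theorem 1(b) and its proof. [cite: LiebPRL1989, Theorem 1] -/
theorem lieb_attractive_holds : lieb_attractive G := by
  intro hG t U ht hU N hN hNle
  obtain ⟨n, rfl⟩ := hN
  set H := hamiltonian G t U with hH
  set E₀ : ℝ := groundEnergy H (n + n) with hE₀
  have hEv : ∀ φ : Fock (Orb Λ), IsInSector n n φ →
      E₀ * (star φ ⬝ᵥ φ).re ≤ (expect H φ).re :=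
    fun φ hφ => groundEnergy_mul_norm_le H hφ.isNParticle
  obtain ⟨huniq, hdiag⟩ := lieb_core G hG ht hU n hEv
  have hcommP : Commute H spinPlus := hamiltonian_commute_spinPlus G t U
  have hcommM : Commute H Literature.MathematicalPhysics.QuantumLattice.spinMinus := hamiltonian_commute_spinMinus G t U
  -- eigenvectors are mapped to eigenvectors (or zero) by `S⁺`, `S⁻`
  have heigP : ∀ v : Fock (Orb Λ), H *ᵥ v = (E₀ : ℂ) • v →
      H *ᵥ (spinPlus *ᵥ v) = (E₀ : ℂ) • (spinPlus *ᵥ v) := by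
    intro v hv
    rw [mulVec_mulVec, hcommP.eq, ← mulVec_mulVec, hv, mulVec_smul]
  have heigM : ∀ v : Fock (Orb Λ), H *ᵥ v = (E₀ : ℂ) • v →
      H *ᵥ (Literature.MathematicalPhysics.QuantumLattice.spinMinus *ᵥ v) = (E₀ : ℂ) • (Literature.MathematicalPhysics.QuantumLattice.spinMinus *ᵥ v) := by
    intro v hv
    rw [mulVec_mulVec, hcommM.eq, ← mulVec_mulVec, hv, mulVec_smul]
  -- a fully paired configuration exists (`n ≤ |Λ|`)
  have hn : n ≤ Fintype.card Λ := by omega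
  obtain ⟨α₀, -, hα₀⟩ : ∃ α₀ : Finset Λ, α₀ ⊆ univ ∧ α₀.card = n :=
    Finset.exists_subset_card_eq hn
  -- Sub-claim A: `(n, n)` eigenvectors at `E₀` are killed by `S⁺` and `S⁻`
  have hA : ∀ w : Fock (Orb Λ), IsInSector n n w → H *ᵥ w = (E₀ : ℂ) • w →
      spinPlus *ᵥ w = 0 ∧ Literature.MathematicalPhysics.QuantumLattice.spinMinus *ᵥ w = 0 := by
    intro w hw hHw
    by_cases hw0 : w = 0
    · subst hw0
      simp
    cases n with
    | zero =>
      exact ⟨raisesSpin_spinPlus.mulVec_eq_zero hw, lowersSpin_spinMinus.mulVec_eq_zero hw⟩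
    | succ k =>
      constructor
      · -- `u = S⁻ S⁺ w` is an `(n, n)` eigenvector, hence `u = c w`; evaluate at `α₀↑ ∪ α₀↓`
        set u := Literature.MathematicalPhysics.QuantumLattice.spinMinus *ᵥ (spinPlus *ᵥ w) with hu
        have hu1 : IsInSector (k + 1) (k + 1) u :=
          lowersSpin_spinMinus.isInSector_mulVec (raisesSpin_spinPlus.isInSector_mulVec hw)
        have hu2 : H *ᵥ u = (E₀ : ℂ) • u := heigM _ (heigP _ hHw)
        obtain ⟨c, hc⟩ := huniq w u hw hu1 hHw hu2 hw0
        have hc0 : c = 0 := by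
          have h1 : u (pairSet α₀ α₀) = 0 := by
            rw [hu, mulVec_mulVec]
            exact spinMinus_mul_spinPlus_mulVec_pairSet_self w α₀
          rw [hc, Pi.smul_apply, smul_eq_mul] at h1
          exact (mul_eq_zero.1 h1).resolve_right (hdiag w hw hHw hw0 ⟨α₀, hα₀⟩)
        rw [hc0, zero_smul] at hc
        have h2 : star (spinPlus *ᵥ w) ⬝ᵥ (spinPlus *ᵥ w) = 0 := by
          rw [← star_dotProduct_conjTranspose_mul_mulVec, ← mulVec_mulVec]
          change star w ⬝ᵥ u = 0
          rw [hc, dotProduct_zero]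
        exact dotProduct_star_self_eq_zero.1 h2
      · set u := spinPlus *ᵥ (Literature.MathematicalPhysics.QuantumLattice.spinMinus *ᵥ w) with hu
        have hu1 : IsInSector (k + 1) (k + 1) u :=
          raisesSpin_spinPlus.isInSector_mulVec (lowersSpin_spinMinus.isInSector_mulVec hw)
        have hu2 : H *ᵥ u = (E₀ : ℂ) • u := heigP _ (heigM _ hHw)
        obtain ⟨c, hc⟩ := huniq w u hw hu1 hHw hu2 hw0
        have hc0 : c = 0 := by
          have h1 : u (pairSet α₀ α₀) = 0 := by
            rw [hu, mulVec_mulVec]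
            exact spinPlus_mul_spinMinus_mulVec_pairSet_self w α₀
          rw [hc, Pi.smul_apply, smul_eq_mul] at h1
          exact (mul_eq_zero.1 h1).resolve_right (hdiag w hw hHw hw0 ⟨α₀, hα₀⟩)
        rw [hc0, zero_smul] at hc
        have h2 : star (Literature.MathematicalPhysics.QuantumLattice.spinMinus *ᵥ w) ⬝ᵥ (Literature.MathematicalPhysics.QuantumLattice.spinMinus *ᵥ w) = 0 := by
          rw [← star_dotProduct_conjTranspose_mul_mulVec, ← mulVec_mulVec]
          change star w ⬝ᵥ (spinPlusᴴᴴ *ᵥ (Literature.MathematicalPhysics.QuantumLattice.spinMinus *ᵥ w)) = 0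
          rw [conjTranspose_conjTranspose, ← hu, hc, dotProduct_zero]
        exact dotProduct_star_self_eq_zero.1 h2
  -- Sub-claim B: eigenvectors at `E₀` in sectors `(a, b)` with `a > b`, `a + b = 2n`, vanish
  have hB : ∀ j b : ℕ, ∀ v : Fock (Orb Λ), b + (j + 1) = n → IsInSector (b + 2 * (j + 1)) b v →
      H *ᵥ v = (E₀ : ℂ) • v → v = 0 := by
    intro j
    induction j with
    | zero =>
      intro b v hb hv hHv
      have hv' : IsInSector (b + 1) (b + 1) (Literature.MathematicalPhysics.QuantumLattice.spinMinus *ᵥ v) :=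
        lowersSpin_spinMinus.isInSector_mulVec (by simpa [two_mul, add_assoc] using hv)
      have hn' : b + 1 = n := by omega
      rw [hn'] at hv'
      have h1 := (hA _ hv' (heigM v hHv)).1
      have h2 : star (Literature.MathematicalPhysics.QuantumLattice.spinMinus *ᵥ v) ⬝ᵥ (Literature.MathematicalPhysics.QuantumLattice.spinMinus *ᵥ v) = 0 := by
        rw [← star_dotProduct_conjTranspose_mul_mulVec, ← mulVec_mulVec]
        change star v ⬝ᵥ (spinPlusᴴᴴ *ᵥ (Literature.MathematicalPhysics.QuantumLattice.spinMinus *ᵥ v)) = 0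
        rw [conjTranspose_conjTranspose, h1, dotProduct_zero]
      exact eq_zero_of_spinMinus_mulVec_eq_zero (by omega) hv (dotProduct_star_self_eq_zero.1 h2)
    | succ j ih =>
      intro b v hb hv hHv
      have e : b + 2 * (j + 1 + 1) = (b + 1 + 2 * (j + 1)) + 1 := by ring
      rw [e] at hv
      have hv' : IsInSector (b + 1 + 2 * (j + 1)) (b + 1) (Literature.MathematicalPhysics.QuantumLattice.spinMinus *ᵥ v) :=
        lowersSpin_spinMinus.isInSector_mulVec hv
      have h1 := ih (b + 1) _ (by omega) hv' (heigM v hHv)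
      exact eq_zero_of_spinMinus_mulVec_eq_zero (by omega) hv h1
  -- Sub-claim B': the same for `a < b`
  have hB' : ∀ j a : ℕ, ∀ v : Fock (Orb Λ), a + (j + 1) = n → IsInSector a (a + 2 * (j + 1)) v →
      H *ᵥ v = (E₀ : ℂ) • v → v = 0 := by
    intro j
    induction j with
    | zero =>
      intro a v ha hv hHv
      have hv' : IsInSector (a + 1) (a + 1) (spinPlus *ᵥ v) :=
        raisesSpin_spinPlus.isInSector_mulVec (by simpa [two_mul, add_assoc] using hv)
      have hn' : a + 1 = n := by omega
      rw [hn'] at hv'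
      have h1 := (hA _ hv' (heigP v hHv)).2
      have h2 : star (spinPlus *ᵥ v) ⬝ᵥ (spinPlus *ᵥ v) = 0 := by
        rw [← star_dotProduct_conjTranspose_mul_mulVec, ← mulVec_mulVec]
        change star v ⬝ᵥ (Literature.MathematicalPhysics.QuantumLattice.spinMinus *ᵥ (spinPlus *ᵥ v)) = 0
        rw [h1, dotProduct_zero]
      exact eq_zero_of_spinPlus_mulVec_eq_zero (by omega) hv (dotProduct_star_self_eq_zero.1 h2)
    | succ j ih =>
      intro a v ha hv hHv
      have e : a + 2 * (j + 1 + 1) = (a + 1 + 2 * (j + 1)) + 1 := by ring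
      rw [e] at hv
      have hv' : IsInSector (a + 1) (a + 1 + 2 * (j + 1)) (spinPlus *ᵥ v) :=
        raisesSpin_spinPlus.isInSector_mulVec hv
      have h1 := ih (a + 1) _ (by omega) hv' (heigP v hHv)
      exact eq_zero_of_spinPlus_mulVec_eq_zero (by omega) hv h1
  -- every ground state lies in the `(n, n)` sector
  have hsector : ∀ ψ : Fock (Orb Λ), IsGroundState H (n + n) ψ → IsInSector n n ψ := by
    rintro ψ ⟨hN, -, hHψ⟩
    have hcomp : ∀ a b : ℕ, H *ᵥ sectorProj a b ψ = (E₀ : ℂ) • sectorProj a b ψ := by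
      intro a b
      rw [(preservesSectors_hamiltonian G t U).mulVec_sectorProj, hHψ, sectorProj_smul]
    have hvan : ∀ a ∈ range (n + n + 1), a ≠ n → sectorProj a (n + n - a) ψ = 0 := by
      intro a ha hne
      rw [mem_range] at ha
      rcases lt_or_gt_of_ne hne with hlt | hgt
      · -- `a < n`: sector `(a, a + 2(j+1))` with `j = n - a - 1`
        obtain ⟨j, hj⟩ : ∃ j, a + (j + 1) = n := ⟨n - a - 1, by omega⟩
        have : n + n - a = a + 2 * (j + 1) := by omega
        rw [this]
        exact hB' j a _ hj (isInSector_sectorProj _ _ _) (hcomp _ _)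
      · obtain ⟨j, hj⟩ : ∃ j, (n + n - a) + (j + 1) = n := ⟨a - n - 1, by omega⟩
        have : a = (n + n - a) + 2 * (j + 1) := by omega
        rw [this]
        exact hB j _ _ hj (by rw [← this]; exact isInSector_sectorProj _ _ _)
          (by rw [← this]; exact hcomp _ _)
    have key : ψ = sectorProj n n ψ := by
      conv_lhs => rw [← sum_sectorProj_eq hN]
      rw [Finset.sum_eq_single n]
      · rw [show n + n - n = n by omega]
      · exact fun a ha hne => hvan a ha hne
      · intro h
        exact absurd (mem_range.2 (by omega)) h
    rw [key]
    exact isInSector_sectorProj n n ψ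
  refine ⟨fun ψ φ hψ hφ => ?_, fun ψ hψ => ?_⟩
  · exact huniq ψ φ (hsector ψ hψ) (hsector φ hφ) hψ.2.2 hφ.2.2 hψ.2.1
  · have hs := hsector ψ hψ
    obtain ⟨hP, hM⟩ := hA ψ hs hψ.2.2
    have hZ : HubbardWave0.spinZ *ᵥ ψ = 0 := by
      rw [spinZ_mulVec_of_isInSector hs, sub_self, mul_zero, zero_smul]
    rw [spinSq, add_mulVec, smul_mulVec, add_mulVec, ← mulVec_mulVec, ← mulVec_mulVec,
      ← mulVec_mulVec, hZ, mulVec_zero, hP, mulVec_zero]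
    change 0 + (1 / 2 : ℂ) • (spinPlus *ᵥ (Literature.MathematicalPhysics.QuantumLattice.spinMinus *ᵥ ψ) + 0) = 0
    rw [hM, mulVec_zero, add_zero, smul_zero, add_zero]

end Discharges

end Literature.MathematicalPhysics.QuantumLattice
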